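import Mathlib
import HarnessLib

/-!
# Jacob–Thiery: no algorithm turns unbiased estimators of `λ ∈ ℝ` into non-negative unbiased
# estimators of `f(λ)` unless `f` is constant (Theorem 2.1), `λ` itself admits no non-negative
# unbiased re-estimation (Lemma 2.1); on a half-line a factory forces monotonicity (Lemma 3.1),
# and power series with non-negative coefficients — e.g. the Poisson estimator of `exp(λ)` — DO
# have factories on `[a, ∞)` (§3.1); on a bounded interval `[a, b]` a factory forces the
# polynomial lower bound `f(x) ≥ ε min((x−a)ⁿ, (b−x)ⁿ)` (Theorem 3.1, necessity)

HONEST FRAMING: exact (Metropolis-corrected) sampling algorithms for lattice gauge theory;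
figures of merit are autocorrelation/cost numbers at stated couplings and volumes; no
continuum-physics claim.

Topic `Probability/Moments` (companions: `RandomizedTruncation.lean` — the signed unbiased
estimators whose sign problem this theorem explains; `BhanotKennedyEstimator.lean`;
`PseudoMarginal*.lean` under `MarkovChains`, which REQUIRE non-negative unbiased estimates).
PUBLISHED RESULT with our formalisation (Mathlib: product measures `Measure.infinitePi`,
`Measure.pi`, Lebesgue integral); every statement proved, no named fact.

Source (READ at the locators).  P. E. Jacob, A. H. Thiery, *On nonnegative unbiased estimators*,
Ann. Statist. 43 (2015) 769–784 [arXiv:1309.6473] [JacobThiery2015], §2: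
* **Definition 1** ("An `𝒳`-algorithm `𝒜` is a pair `(T, φ)` where `T = (T_n)`, `T_n : (0,1) × 𝒳ⁿ →
  {0,1}`, and `φ = (φ_n)`, `φ_n : (0,1) × 𝒳ⁿ → ℝ⁺` … takes an infinite sequence `x ∈ 𝒳^∞` and an
  auxiliary variable `u ∈ (0,1)` as input and produces as output `𝒜(u,x) = φ_τ(u, x_1, …, x_τ)` with
  `τ = inf{n ≥ 1 : T_n(u, x_1, …, x_n) = 1}` … convention `𝒜(u,x) = ∞` when … the algorithm does
  not terminate"; "Specifying a single auxiliary variable `U ∼ Uniform(0,1)` or an infinite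
  independent sequence … is equivalent");
* **Definition 2** ("An `f`-factory … is an `𝒳`-algorithm such that for any distribution
  `π ∈ ℳ₁(𝒳)`, an independent sequence `X = (X_n)` marginally distributed as `π` and an auxiliary
  random variable `U ∼ Uniform(0,1)` independent of `(X_n)`, the random variable `Y = 𝒜(U, X)` is a
  nonnegative unbiased estimator of `f(m₁(π))`");
* **Theorem 2.1** ("For any nonconstant function `f : ℝ → ℝ⁺`, no `f`-factory exists") with its
  proof: the mixture `μ_Y(dy) = (1−ε) μ_X(dy) + ε 1_{ε⁻¹(λ_Y − λ_X(1−ε))}(dy)`, the sets `L_n =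
  {τ_X ≤ n}`, `M_n = {B_1 = ⋯ = B_n = 1}`, the chain "(eqnonneg) `E_{U,Y}(φ_{τ_Y}) ≥
  Ě(φ_{τ_Y} 1_{L_n ∩ M_n}) = Ě(φ_{τ_X} 1_{L_n ∩ M_n})`", "(eqbernoulli) `= (1−ε)ⁿ E_{U,X}(φ_{τ_X}
  1_{L_n})`", "(eqlimit) dominated convergence … `f(λ_X) − δ ≤ E_{U,X}(φ_{τ_X} 1_{L_n}) ≤ f(λ_X)`",
  "We obtain a contradiction for `ε > 0` small enough";
* **Lemma 2.1** ("Let `η ≥ 0` be a known constant.  There does not exist an algorithm … such that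
  for any independent sequence … marginally distributed as `π ∈ ℳ₁(ℝ)` with `m₁(π) > η` … `Y =
  𝒜(U,X)` is a nonnegative unbiased estimator of `m₁(π)`");
and §3.1:
* **Lemma 3.1** ("For an `f`-factory to exist with `𝒳 = [a, ∞)` and `f : 𝒳 → ℝ⁺`, `f` must be
  increasing.  For a `g`-factory to exist with `𝒳 = (−∞, b]` and `g : 𝒳 → ℝ⁺`, `g` must be
  decreasing", proof: "For `ε > 0` small enough we have `𝒟(Y) ∈ ℳ₁([a, ∞))` since `λ_Y > λ_X`.
  One can then construct exactly the same contradiction as in the proof of Theorem 2.1"), the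
  remark "it is impossible to obtain `U⁺`-estimators of `1/λ` given `U⁺`-estimators of a quantity
  `λ > 0`";
* the power-series factories ("there exists an `f`-factory for any function `f : [a, ∞) → ℝ⁺`
  that can be expressed as a power series (eqfanalytic) `f(x) = Σ_{n=0}^{∞} c_n (x − a)^n` with
  `c_n ≥ 0` … introduce an independent sequence `(X_n)` … and an integer-valued random variable
  `N`; setting the weights `w_n = 1/P(N ≥ n)` …, Tonelli's theorem yields that the estimator
  `Y = Σ_{n=0}^{N} w_n c_n ∏_{k=1}^{n} (X_k − a)`, where the product is equal to `1` when `n = 0`,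
  is well defined, is almost surely nonnegative and has expectation `f(m₁(μ_X))`") and the
  **Poisson estimator** ("an estimator of `λ = exp(E[X])` given a stream of i.i.d.
  `[a, +∞)`-valued random variables … with `c_n = exp(a)/n!`").

Lean reading.
* `Algorithm S` — Definition 1 with the auxiliary randomness valued in ANY measurable space `S`
  with any probability law `ν` (the paper's `U ∼ Uniform(0,1)`; "specifying a single auxiliary
  variable … or an infinite independent sequence … is equivalent" — the proof never uses the form
  of `ν`): `stop n` / `out n` are measurable maps of `(u, x) : S × (ℕ → ℝ)` that are ADAPTED —
  they depend on `x` only through `x_0, …, x_{n−1}` (the printed `T_n(u, x_1, …, x_n)`,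
  `φ_n(u, x_1, …, x_n)`; our index `n` counts the inputs read, `n = 0` allowed).
* `run A (u, x) ∈ ℝ≥0∞` — the output `φ_τ(u, x_1..x_τ)` at the first stopping index, `⊤` if the
  algorithm never stops (the printed convention `𝒜 = ∞`); `runBy A n` — the output on the event
  `{τ ≤ n}` (`φ_τ 1_{L_n}`), `0` elsewhere.
* `inputLaw ν π = ν ⊗ π^{⊗ℕ}` — the joint law of `(U, (X_n))`, "independent sequence marginally
  distributed as `π` … `U` … independent of `(X_n)`"; `IsFactory A ν f` — Definition 2 for
  `𝒳 = ℝ`: for EVERY probability law `π` on `ℝ` with finite first moment,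
  `E[run] = f(∫ x dπ)` (as an `ℝ≥0∞`-valued integral; finiteness of `f` forces a.s. termination).
* THE COUPLING, measure-theoretically: instead of carrying the Bernoulli variables `B_n` we use
  what (eqnonneg)–(eqbernoulli) compute, namely the domination of finite-dimensional laws
  `μ_Y^{⊗n} ≥ (1−ε)ⁿ μ_X^{⊗n}` (`pi_mixture_ge`), applied to `φ_τ 1_{L_n}`, which is a function of
  `(u, x_1, …, x_n)` only (`runBy_eq_comp_restrict`).
* `IsFactoryOn A ν 𝒳 f` — Definition 2 for a state space `𝒳 ⊆ ℝ`: the identity is required for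
  the laws `π` carried by `𝒳` (`π`-a.e. `x ∈ 𝒳`); `IsFactory = IsFactoryOn univ`.
* `seriesAlgorithm a c w : Algorithm ℕ` — the §3.1 construction: the auxiliary variable IS the
  integer `N` (law `ν` on `ℕ`), `T_n = 1{n = N}`, `φ_n = (Σ_{j ≤ n} w_j c_j ∏_{k<j} (x_k − a))⁺`
  (the positive part is the identity on `[a, ∞)`-valued inputs, `seriesSum_nonneg`);
  `debiasWeight ν n = 1/ν([n, ∞)) = 1/P(N ≥ n)`.

Contents (all proved).
* `Algorithm`, `stopped`, `Terminates`, `runBy`, `run`, `inputLaw`, `mixture`, `IsFactory`;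
  `run_eq_of_stopped` (`𝒜(u,x) = φ_τ`), `run_eq_top` (non-termination), `runBy_le_run`,
  `iSup_runBy`, `runBy_congr` / `runBy_eq_comp_restrict` (adaptedness: `φ_τ 1_{L_n}` is a
  measurable function of `(u, x_0, …, x_{n−1})`), `inputLaw_map_restrict` (its law is `ν ⊗ π^{⊗n}`).
* `pi_smul_le_pi` / `pi_mixture_ge` — the finite-dimensional form of (eqbernoulli):
  `(1−ε)ⁿ μ_X^{⊗n} ≤ μ_Y^{⊗n}` for `μ_Y = (1−ε)μ_X + ε δ_c`.
* `Algorithm.lintegral_runBy_mixture_ge` — (eqnonneg) + (eqbernoulli):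
  `(1−ε)ⁿ E_{U,X}[φ_τ 1_{L_n}] ≤ E_{U,Y}[φ_τ]`, EVERY `c`, every `n`.
* `Algorithm.iSup_lintegral_runBy` — (eqlimit): `E[φ_τ 1_{L_n}] ↑ E[φ_τ]` once `E[φ_τ] < ∞`
  (which forces almost-sure termination).
* `lintegral_run_le_of_mixtures`, **`IsFactory.apply_le`** — the heart of the proof: an
  `f`-factory has `f(λ_X) ≤ f(λ_Y)` for ALL `λ_X, λ_Y` (take `μ_X = δ_{λ_X}`,
  `c = ε⁻¹(λ_Y − λ_X(1−ε))`, `ε = 1/(m+2) → 0`, then `n → ∞`).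
* **`JacobThiery2015_thm_2_1`** / `JacobThiery2015_thm_2_1'` — THEOREM 2.1: an `f`-factory exists
  only for constant `f`; `not_isFactory_exp` (the paper's example `exp`); `isFactory_const`
  (constants DO have factories — non-vacuity of Definition 2).
* **`JacobThiery2015_lemma_2_1`** — LEMMA 2.1: for every `η ≥ 0` there is no algorithm whose output
  is a non-negative unbiased estimator of `m₁(π)` for all `π` with `m₁(π) > η`.
* `IsFactoryOn.apply_le` (the coupling argument on a general `𝒳`: `f(λ_X) ≤ f(λ_Y)` as soon as
  `λ_X ∈ 𝒳` and the Dirac points `λ_X + (λ_Y − λ_X)/ε` stay in `𝒳`), **`JacobThiery2015_lemma_3_1_Ici`**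
  (LEMMA 3.1: a factory on `[a, ∞)` has `f` monotone), **`JacobThiery2015_lemma_3_1_Iic`** (on
  `(−∞, b]`: antitone), `not_isFactoryOn_inv` (`1/λ` from `λ ≥ a > 0`: impossible).
* `seriesSum`, `seriesAlgorithm`, `seriesAlgorithm_run`, `debiasWeight`, `ofReal_debiasWeight_mul`
  (`w_n P(N ≥ n) = 1`), `tsum_sum_range_mul_measure_singleton` (Tonelli over `N`),
  `lintegral_prod_sub_eq` (`E ∏_{k<j}(X_k − a) = (m₁ − a)^j` by independence),
  `lintegral_seriesSum_eq`, **`isFactoryOn_seriesAlgorithm`** (`𝓕 ⊆ 𝓒`: every `f(x) = Σ c_n (x−a)^n`,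
  `c_n ≥ 0`, has a factory on `[a, ∞)`, for every law of `N` with `P(N ≥ n) > 0`),
  **`isFactoryOn_exp`** (the Poisson estimator, `c_n = e^a/n!`: `exp` has a factory on every
  `[a, ∞)` although none on `ℝ`, `not_isFactory_exp`).

* §3.2 (`𝒳 = [a, b]`): `twoPoint a b z` (the Bernoulli input laws `(1−z)δ_a + zδ_b ∈ ℳ₁([a,b])`,
  mean `a + z(b−a)`), `pattern`, `Algorithm.condOut` (the printed `Ψ_n(x_{1:n})`),
  `Algorithm.lintegral_runBy_eq_lintegral_condOut` (`E[φ_τ 1_{τ≤n}] = E[Ψ_n(X_{1:n})]`),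
  `pow_le_pi_twoPoint_pattern` (`P_z(X_{1:n} = x_{1:n}) ≥ min(z,1−z)ⁿ`),
  `condOut_mul_le_lintegral_run`, `exists_condOut_pos`, and
  **`JacobThiery2015_thm_3_1_necessity`** — THEOREM 3.1, "only if" half: an `f`-factory on `[a,b]`
  with `f ≢ 0` forces `∃ ε > 0, ∃ n, ∀ x ∈ [a,b], f(x) ≥ ε min((x−a)ⁿ, (b−x)ⁿ)`; corollaries
  `IsFactoryOn.pos_of_mem_Ioo` (`f > 0` on `(a,b)`), `not_isFactoryOn_of_zero_mem_Ioo`.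

Deliberate omissions / TODO(general form): the finite-variance remark for geometric `N`
(§3.1, via Theorem 1.1), the closure of `𝓒` under sums / products / composition and the
unproved equality `𝓕 = 𝓒` suggested by the authors (not vendored: the source gives no proof),
the SUFFICIENCY half of §3.2 Theorem 3.1 (it rests on the Keane–O'Brien 1994 construction of
Bernoulli factories, absent from the tree) and §4 (Bernoulli-factory based pseudo-marginal
schemes) are not formalised.

Context (cell pub-lqcd, HOME/R2-SCOPE.md §3 D2–D3 / §5 INVALID-4 = X-5b): an exact
pseudo-marginal step for the fermion determinant needs a NON-NEGATIVE unbiased estimate of the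
weight; unbiased estimates of `log det` or of signed series for `det`-ratios are real-valued with
unbounded support, and Theorem 2.1 says no post-processing whatsoever (randomised, sequential,
of any cost) makes them non-negative and unbiased for a non-constant target such as `exp` — the
options are a priori ONE-SIDED bounds (§3.1: with inputs known to lie in `[a, ∞)` the Poisson
estimator `isFactoryOn_exp` is exact and non-negative) or carrying the sign.
-/

noncomputable section

namespace Literature.Probability.Moments

open _root_.MeasureTheory _root_.ProbabilityTheory Filter Topology Set Finset
open scoped ENNReal NNReal

namespace NonnegativeUnbiased

/-! ## Definition 1: algorithms -/

/-- **DEFINITION 1** (`𝒳 = ℝ`, auxiliary randomness in a measurable space `S`): an algorithm is a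
pair of sequences of measurable maps `stop n = T_n` (`Bool`-valued) and `out n = φ_n`
(`ℝ≥0`-valued) of `(u, x) ∈ S × ℝ^ℕ` which are ADAPTED: `T_n`, `φ_n` read only the first `n`
inputs `x_0, …, x_{n−1}`. [cite: JacobThiery2015, §2.1 Definition 1] -/
structure Algorithm (S : Type*) [MeasurableSpace S] where
  /-- `T_n(u, x_1, …, x_n) ∈ {0,1}`: stop after reading `n` inputs? -/
  stop : ℕ → S × (ℕ → ℝ) → Bool
  /-- `φ_n(u, x_1, …, x_n) ∈ ℝ⁺`: the output if stopped after `n` inputs. -/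
  out : ℕ → S × (ℕ → ℝ) → ℝ≥0
  measurable_stop : ∀ n, Measurable (stop n)
  measurable_out : ∀ n, Measurable (out n)
  stop_adapted : ∀ n (u : S) (x y : ℕ → ℝ), (∀ k < n, x k = y k) → stop n (u, x) = stop n (u, y)
  out_adapted : ∀ n (u : S) (x y : ℕ → ℝ), (∀ k < n, x k = y k) → out n (u, x) = out n (u, y)

variable {S : Type*} [MeasurableSpace S]

namespace Algorithm

variable (A : Algorithm S)

/-- "`τ = k`": the algorithm stops for the first time after `k` inputs.
[cite: JacobThiery2015, §2.1 Definition 1 (`τ = inf{n : T_n = 1}`)] -/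
def stopped (k : ℕ) (p : S × (ℕ → ℝ)) : Prop :=
  A.stop k p = true ∧ ∀ j < k, A.stop j p = false

/-- The algorithm terminates: some `T_n = 1`. [cite: JacobThiery2015, §2.1 Definition 1 ("we say
… that the algorithm almost surely terminates if `P(τ < ∞) = 1`")] -/
def Terminates (p : S × (ℕ → ℝ)) : Prop := ∃ k, A.stop k p = true

/-- `φ_τ 1_{τ ≤ n}`: the output on the event `L_n = {τ ≤ n}`, zero elsewhere.
[cite: JacobThiery2015, §2.2 (proof of Theorem 2.1: `L_n = {ω : τ_X ≤ n}`)] -/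
def runBy (n : ℕ) (p : S × (ℕ → ℝ)) : ℝ≥0∞ :=
  ∑ k ∈ range (n + 1), {p | A.stopped k p}.indicator (fun p => (A.out k p : ℝ≥0∞)) p

/-- THE OUTPUT `𝒜(u, x) = φ_τ(u, x_1, …, x_τ)` (`= sup_n φ_τ 1_{τ ≤ n}`), with "the convention
`𝒜(u,x) = ∞`" when the algorithm does not terminate. [cite: JacobThiery2015, §2.1 Definition 1] -/
def run (p : S × (ℕ → ℝ)) : ℝ≥0∞ :=
  (⨆ n, A.runBy n p) + {p | ¬ A.Terminates p}.indicator (fun _ => ⊤) p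

/-- `{τ = k}` is a decidable event (Boolean tests). [cite: JacobThiery2015, §2.1 Definition 1] -/
instance (k : ℕ) (p : S × (ℕ → ℝ)) : Decidable (A.stopped k p) := by
  unfold stopped; infer_instance

/-- Two first-stopping indices coincide. [cite: JacobThiery2015, §2.1 Definition 1] -/
theorem stopped_unique {k l : ℕ} {p : S × (ℕ → ℝ)} (hk : A.stopped k p) (hl : A.stopped l p) :
    k = l := by
  rcases lt_trichotomy k l with h | h | h
  · have := hl.2 k h; rw [hk.1] at this; exact absurd this (by simp)
  · exact h
  · have := hk.2 l h; rw [hl.1] at this; exact absurd this (by simp)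

/-- A terminating run has a (unique) first stopping index. [cite: JacobThiery2015, §2.1
Definition 1 (`τ = inf{…}`)] -/
theorem exists_stopped_of_terminates {p : S × (ℕ → ℝ)} (h : A.Terminates p) : ∃ k, A.stopped k p := by
  classical
  refine ⟨Nat.find h, Nat.find_spec h, fun j hj => ?_⟩
  have := Nat.find_min h hj
  simpa using this

/-- A stopped run terminates. [cite: JacobThiery2015, §2.1 Definition 1] -/
theorem terminates_of_stopped {k : ℕ} {p : S × (ℕ → ℝ)} (h : A.stopped k p) : A.Terminates p :=
  ⟨k, h.1⟩

/-- `φ_τ 1_{τ ≤ n} = φ_k` on `{τ = k}`, `k ≤ n`. [cite: JacobThiery2015, §2.2 (proof of Thm 2.1)] -/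
theorem runBy_eq_of_stopped {k n : ℕ} {p : S × (ℕ → ℝ)} (h : A.stopped k p) (hkn : k ≤ n) :
    A.runBy n p = A.out k p := by
  unfold runBy
  rw [Finset.sum_eq_single k (fun l _ hl => ?_) (fun hk => ?_)]
  · simp [Set.indicator_of_mem (show p ∈ {p | A.stopped k p} from h)]
  · exact Set.indicator_of_notMem
      (show p ∉ {q | A.stopped l q} from fun hl' => hl (A.stopped_unique hl' h)) _
  · exact absurd (Finset.mem_range.mpr (Nat.lt_succ_of_le hkn)) hk

/-- `φ_τ 1_{τ ≤ n} = 0` off `{τ ≤ n}`. [cite: JacobThiery2015, §2.2 (proof of Thm 2.1)] -/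
theorem runBy_eq_zero {n : ℕ} {p : S × (ℕ → ℝ)} (h : ∀ k ≤ n, ¬ A.stopped k p) :
    A.runBy n p = 0 := by
  unfold runBy
  refine Finset.sum_eq_zero (fun k hk => ?_)
  exact Set.indicator_of_notMem
    (show p ∉ {q | A.stopped k q} from h k (Nat.lt_succ_iff.mp (Finset.mem_range.mp hk))) _

/-- `φ_τ 1_{τ ≤ n}` is non-decreasing in `n`. [cite: JacobThiery2015, §2.2 (the sets `L_n`)] -/
theorem runBy_mono (p : S × (ℕ → ℝ)) : Monotone fun n => A.runBy n p := by
  refine monotone_nat_of_le_succ fun n => ?_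
  unfold runBy
  rw [Finset.sum_range_succ _ (n + 1)]
  exact le_self_add

/-- On `{τ = k}`: `sup_n φ_τ 1_{τ ≤ n} = φ_k`. [cite: JacobThiery2015, §2.1 Definition 1] -/
theorem iSup_runBy_eq_of_stopped {k : ℕ} {p : S × (ℕ → ℝ)} (h : A.stopped k p) :
    ⨆ n, A.runBy n p = A.out k p := by
  apply le_antisymm
  · refine iSup_le fun n => ?_
    by_cases hkn : k ≤ n
    · exact (A.runBy_eq_of_stopped h hkn).le
    · rw [A.runBy_eq_zero fun j hj hj' => hkn ((A.stopped_unique hj' h) ▸ hj)]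
      exact bot_le
  · exact le_iSup_of_le k (A.runBy_eq_of_stopped h le_rfl).ge

/-- Off `{τ < ∞}`: every `φ_τ 1_{τ ≤ n}` vanishes. [cite: JacobThiery2015, §2.1 Definition 1] -/
theorem runBy_eq_zero_of_not_terminates {p : S × (ℕ → ℝ)} (h : ¬ A.Terminates p) (n : ℕ) :
    A.runBy n p = 0 :=
  A.runBy_eq_zero fun _ _ hk => h (A.terminates_of_stopped hk)

/-- **`𝒜(u,x) = φ_τ(u, x_1, …, x_τ)`**: on `{τ = k}` the output is `φ_k`.
[cite: JacobThiery2015, §2.1 Definition 1] -/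
theorem run_eq_of_stopped {k : ℕ} {p : S × (ℕ → ℝ)} (h : A.stopped k p) :
    A.run p = A.out k p := by
  unfold run
  rw [A.iSup_runBy_eq_of_stopped h,
    Set.indicator_of_notMem (show p ∉ {p | ¬ A.Terminates p} from
      fun hn => hn (A.terminates_of_stopped h)), add_zero]

/-- **The convention `𝒜(u,x) = ∞`** when the algorithm does not terminate.
[cite: JacobThiery2015, §2.1 Definition 1] -/
theorem run_eq_top {p : S × (ℕ → ℝ)} (h : ¬ A.Terminates p) : A.run p = ⊤ := by
  unfold run
  rw [Set.indicator_of_mem (show p ∈ {p | ¬ A.Terminates p} from h)]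
  exact add_top _

/-- `φ_τ 1_{τ ≤ n} ≤ 𝒜`. [cite: JacobThiery2015, §2.2 (eqnonneg): "Since `φ_{τ_Y}` is almost surely
nonnegative, … `≥ Ě(φ_{τ_Y} 1_{L_n ∩ M_n})`"] -/
theorem runBy_le_run (n : ℕ) (p : S × (ℕ → ℝ)) : A.runBy n p ≤ A.run p := by
  unfold run
  exact (le_iSup (fun n => A.runBy n p) n).trans le_self_add

/-- On a terminating run, `φ_τ 1_{τ ≤ n} = 𝒜` eventually; in general
`⨆_n φ_τ 1_{τ ≤ n} = 𝒜 · 1_{τ < ∞}`. [cite: JacobThiery2015, §2.2 (eqlimit): "The dominated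
convergence theorem yields `lim_n E(φ_{τ_X} 1_{L_n}) = E(φ_{τ_X})`"] -/
theorem iSup_runBy (p : S × (ℕ → ℝ)) :
    ⨆ n, A.runBy n p = {p | A.Terminates p}.indicator A.run p := by
  by_cases h : A.Terminates p
  · obtain ⟨k, hk⟩ := A.exists_stopped_of_terminates h
    rw [Set.indicator_of_mem (show p ∈ {p | A.Terminates p} from h), A.run_eq_of_stopped hk,
      A.iSup_runBy_eq_of_stopped hk]
  · rw [Set.indicator_of_notMem (show p ∉ {p | A.Terminates p} from h)]
    simp [A.runBy_eq_zero_of_not_terminates h]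

/-! ### Measurability -/

/-- `{τ = k}` is measurable. [cite: JacobThiery2015, §2.1 Definition 1] -/
theorem measurableSet_stopped (k : ℕ) : MeasurableSet {p | A.stopped k p} := by
  have e : {p | A.stopped k p} =
      (A.stop k ⁻¹' {true}) ∩ ⋂ j ∈ Finset.range k, (A.stop j ⁻¹' {false}) := by
    ext p
    simp [stopped, Finset.mem_range]
  rw [e]
  exact (A.measurable_stop k (measurableSet_singleton _)).inter
    (Finset.measurableSet_biInter _ fun j _ => A.measurable_stop j (measurableSet_singleton _))

/-- `{τ < ∞}` is measurable. [cite: JacobThiery2015, §2.1 Definition 1] -/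
theorem measurableSet_terminates : MeasurableSet {p | A.Terminates p} := by
  have e : {p | A.Terminates p} = ⋃ k, A.stop k ⁻¹' {true} := by
    ext p
    simp [Terminates]
  rw [e]
  exact MeasurableSet.iUnion fun k => A.measurable_stop k (measurableSet_singleton _)

/-- `φ_τ 1_{τ ≤ n}` is measurable. [cite: JacobThiery2015, §2.2] -/
theorem measurable_runBy (n : ℕ) : Measurable (A.runBy n) := by
  unfold runBy
  exact Finset.measurable_sum _ fun k _ =>
    (A.measurable_out k).coe_nnreal_ennreal.indicator (A.measurableSet_stopped k)

/-- `𝒜` is measurable. [cite: JacobThiery2015, §2.1 Definition 1] -/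
theorem measurable_run : Measurable A.run := by
  unfold run
  refine Measurable.add ?_ ?_
  · exact Measurable.iSup fun n => A.measurable_runBy n
  · exact measurable_const.indicator A.measurableSet_terminates.compl

/-! ### Adaptedness: `φ_τ 1_{τ ≤ n}` is a function of `(u, x_0, …, x_{n−1})` -/

/-- The first `n` inputs as a tuple. [cite: JacobThiery2015, §2.1 Definition 1 (`x_1, …, x_n`)] -/
def restrictFin (n : ℕ) (x : ℕ → ℝ) : Fin n → ℝ := fun i => x i

/-- Re-embedding a tuple as a sequence (padding with `0`). [cite: JacobThiery2015, §2.1] -/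
def padFin (n : ℕ) (t : Fin n → ℝ) : ℕ → ℝ := fun k => if h : k < n then t ⟨k, h⟩ else 0

omit [MeasurableSpace S] in
/-- Padding the restriction recovers the first `n` inputs. [cite: JacobThiery2015, §2.1
Definition 1] -/
theorem padFin_restrictFin {n : ℕ} (x : ℕ → ℝ) : ∀ k < n, padFin n (restrictFin n x) k = x k := by
  intro k hk
  simp [padFin, restrictFin, hk]

/-- Measurability of the restriction. [cite: JacobThiery2015, §2.1 Definition 1] -/
theorem measurable_restrictFin (n : ℕ) : Measurable (restrictFin n) :=
  measurable_pi_lambda _ fun _ => measurable_pi_apply _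

/-- Measurability of the padding. [cite: JacobThiery2015, §2.1 Definition 1] -/
theorem measurable_padFin (n : ℕ) : Measurable (padFin n) := by
  refine measurable_pi_lambda _ fun k => ?_
  by_cases h : k < n
  · simp only [padFin, h]
    exact measurable_pi_apply _
  · simp only [padFin, h]
    exact measurable_const

/-- If two input sequences agree below `n`, the events `{τ = k}`, `k ≤ n`, agree.
[cite: JacobThiery2015, §2.2 (proof of Thm 2.1: "`τ_X 1_{L_n ∩ M_n} = τ_Y 1_{L_n ∩ M_n}`")] -/
theorem stopped_congr {n k : ℕ} (hkn : k ≤ n) {u : S} {x y : ℕ → ℝ} (hxy : ∀ j < n, x j = y j) :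
    A.stopped k (u, x) ↔ A.stopped k (u, y) := by
  have hs : ∀ j ≤ k, A.stop j (u, x) = A.stop j (u, y) := fun j hj =>
    A.stop_adapted j u x y fun i hi => hxy i (lt_of_lt_of_le hi (hj.trans hkn))
  simp only [stopped, hs k le_rfl]
  constructor
  · rintro ⟨h1, h2⟩; exact ⟨h1, fun j hj => (hs j hj.le) ▸ h2 j hj⟩
  · rintro ⟨h1, h2⟩; exact ⟨h1, fun j hj => (hs j hj.le).symm ▸ h2 j hj⟩

/-- **ADAPTEDNESS**: `φ_τ 1_{τ ≤ n}` takes the same value on input sequences that agree below `n`.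
[cite: JacobThiery2015, §2.2 (proof of Thm 2.1: on `L_n ∩ M_n`, `φ_{τ_Y}(U, Y_1..Y_{τ_Y}) =
φ_{τ_X}(U, X_1..X_{τ_X})`)] -/
theorem runBy_congr (n : ℕ) {u : S} {x y : ℕ → ℝ} (hxy : ∀ j < n, x j = y j) :
    A.runBy n (u, x) = A.runBy n (u, y) := by
  by_cases h : ∃ k ≤ n, A.stopped k (u, x)
  · obtain ⟨k, hkn, hk⟩ := h
    have hk' : A.stopped k (u, y) := (A.stopped_congr hkn hxy).mp hk
    rw [A.runBy_eq_of_stopped hk hkn, A.runBy_eq_of_stopped hk' hkn]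
    exact congrArg _ (A.out_adapted k u x y fun i hi => hxy i (lt_of_lt_of_le hi hkn))
  · push Not at h
    have h' : ∀ k ≤ n, ¬ A.stopped k (u, y) := fun k hkn hk =>
      h k hkn ((A.stopped_congr hkn hxy).mpr hk)
    rw [A.runBy_eq_zero h, A.runBy_eq_zero h']

/-- `φ_τ 1_{τ ≤ n}` as a function of `(u, (x_0, …, x_{n−1}))`. [cite: JacobThiery2015, §2.2] -/
def runByFin (n : ℕ) (q : S × (Fin n → ℝ)) : ℝ≥0∞ := A.runBy n (q.1, padFin n q.2)

/-- Measurability of `φ_τ 1_{τ ≤ n}` as a function of the first `n` inputs.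
[cite: JacobThiery2015, §2.2] -/
theorem measurable_runByFin (n : ℕ) : Measurable (A.runByFin n) :=
  (A.measurable_runBy n).comp (measurable_fst.prodMk ((measurable_padFin n).comp measurable_snd))

/-- `φ_τ 1_{τ ≤ n} = runByFin n ∘ (u, restriction to the first n inputs)`.
[cite: JacobThiery2015, §2.2 (proof of Thm 2.1)] -/
theorem runBy_eq_comp_restrict (n : ℕ) (p : S × (ℕ → ℝ)) :
    A.runBy n p = A.runByFin n (Prod.map id (restrictFin n) p) := by
  rcases p with ⟨u, x⟩
  simp only [runByFin, Prod.map, id]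
  exact A.runBy_congr n fun j hj => (padFin_restrictFin x j hj).symm

end Algorithm

/-! ## Definition 2: the input law and `f`-factories -/

/-- The joint law of `(U, X_1, X_2, …)`: `U ∼ ν` independent of the i.i.d. sequence `X_n ∼ π`.
[cite: JacobThiery2015, §2.1 Definition 2 ("an independent sequence `X = (X_n)` marginally
distributed as `π` and an auxiliary random variable `U` … independent of `(X_n)`")] -/
def inputLaw (ν : Measure S) (π : Measure ℝ) [IsProbabilityMeasure π] : Measure (S × (ℕ → ℝ)) :=
  ν.prod (Measure.infinitePi fun _ : ℕ => π)

/-- The input law is a probability law. [cite: JacobThiery2015, §2.1 Definition 2] -/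
instance (ν : Measure S) [IsProbabilityMeasure ν] (π : Measure ℝ) [IsProbabilityMeasure π] :
    IsProbabilityMeasure (inputLaw ν π) := by
  unfold inputLaw; infer_instance

/-- **DEFINITION 2** (`𝒳 = ℝ`): `𝒜` is an `f`-FACTORY if for EVERY probability law `π` on `ℝ` with
finite first moment its output is a (non-negative, by construction) unbiased estimator of
`f(m₁(π))`: `E[𝒜(U,X)] = f(∫ x π(dx))`. [cite: JacobThiery2015, §2.1 Definition 2] -/
def IsFactory (A : Algorithm S) (ν : Measure S) (f : ℝ → ℝ≥0) : Prop :=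
  ∀ (π : Measure ℝ) [IsProbabilityMeasure π], Integrable (fun x : ℝ => x) π →
    ∫⁻ p, A.run p ∂(inputLaw ν π) = f (∫ x, x ∂π)

/-- **DEFINITION 2 for a general state space `𝒳 ⊆ ℝ`**: `𝒜` is an `f`-FACTORY ON `X` if for
every probability law `π ∈ ℳ₁(𝒳)` — a law on `ℝ` carried by `X` (`π`-a.e. `x ∈ X`) — with finite
first moment, `E[𝒜(U, X)] = f(m₁(π))`.  `IsFactory` is the case `𝒳 = ℝ` (`isFactoryOn_univ_iff`).
[cite: JacobThiery2015, §2.1 Definition 2 ("for any distribution `π ∈ ℳ₁(𝒳)`")] -/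
def IsFactoryOn (A : Algorithm S) (ν : Measure S) (X : Set ℝ) (f : ℝ → ℝ≥0) : Prop :=
  ∀ (π : Measure ℝ) [IsProbabilityMeasure π], Integrable (fun x : ℝ => x) π →
    (∀ᵐ x ∂π, x ∈ X) → ∫⁻ p, A.run p ∂(inputLaw ν π) = f (∫ x, x ∂π)

/-- `𝒳 = ℝ`: a factory on `univ` is a factory. [cite: JacobThiery2015, §2.1 Definition 2] -/
theorem isFactoryOn_univ_iff {A : Algorithm S} {ν : Measure S} {f : ℝ → ℝ≥0} :
    IsFactoryOn A ν Set.univ f ↔ IsFactory A ν f :=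
  ⟨fun h π _ hi => h π hi (ae_of_all _ fun x => Set.mem_univ x), fun h π _ hi _ => h π hi⟩

/-- A factory (inputs from all of `ℳ₁(ℝ)`) is a factory on every `𝒳 ⊆ ℝ`.
[cite: JacobThiery2015, §2.1 Definition 2] -/
theorem IsFactory.isFactoryOn {A : Algorithm S} {ν : Measure S} {f : ℝ → ℝ≥0}
    (hA : IsFactory A ν f) (X : Set ℝ) : IsFactoryOn A ν X f :=
  fun π _ hi _ => hA π hi

/-! ## The mixture `μ_Y = (1 − ε) μ_X + ε δ_c` -/

/-- The law of `Y_n = B_n X_n + c (1 − B_n)`, `P(B_n = 1) = 1 − ε`: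
`μ_Y = (1−ε) μ_X + ε δ_c`. [cite: JacobThiery2015, §2.2 (proof of Thm 2.1, display defining `μ_Y`)] -/
def mixture (π : Measure ℝ) (ε c : ℝ) : Measure ℝ :=
  ENNReal.ofReal (1 - ε) • π + ENNReal.ofReal ε • Measure.dirac c

/-- `μ_Y` is a probability law ("`μ_Y ∈ ℳ₁(ℝ)`"). [cite: JacobThiery2015, §2.2 (proof of Thm 2.1,
display defining `μ_Y`)] -/
theorem isProbabilityMeasure_mixture (π : Measure ℝ) [IsProbabilityMeasure π] {ε : ℝ}
    (hε : ε ∈ Icc (0 : ℝ) 1) (c : ℝ) : IsProbabilityMeasure (mixture π ε c) := by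
  constructor
  simp only [mixture, Measure.coe_add, Measure.coe_smul, Pi.add_apply, Pi.smul_apply, measure_univ,
    smul_eq_mul, mul_one]
  rw [← ENNReal.ofReal_add (by linarith [hε.2]) hε.1]
  simp

/-- `μ_Y ≥ (1−ε) μ_X`. [cite: JacobThiery2015, §2.2 (eqbernoulli)] -/
theorem smul_le_mixture (π : Measure ℝ) (ε c : ℝ) : ENNReal.ofReal (1 - ε) • π ≤ mixture π ε c :=
  Measure.le_add_right le_rfl

/-- `μ_Y` has a finite first moment when `μ_X` has. [cite: JacobThiery2015, §2.2 (`μ_Y ∈ ℳ₁(ℝ)`)] -/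
theorem integrable_mixture {π : Measure ℝ} (hi : Integrable (fun x : ℝ => x) π) (ε c : ℝ) :
    Integrable (fun x : ℝ => x) (mixture π ε c) := by
  unfold mixture
  exact (hi.smul_measure (by simp)).add_measure
    ((integrable_dirac (by simp)).smul_measure (by simp))

/-- The mean of the mixture: `m₁(μ_Y) = (1−ε) m₁(μ_X) + ε c` — `= λ_Y` for the printed choice
`c = ε⁻¹(λ_Y − λ_X(1−ε))`. [cite: JacobThiery2015, §2.2 (proof of Thm 2.1: "is such that
`E(Y_n) = λ_Y`")] -/
theorem integral_mixture {π : Measure ℝ} [IsProbabilityMeasure π]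
    (hi : Integrable (fun x : ℝ => x) π) {ε : ℝ} (hε : ε ∈ Icc (0 : ℝ) 1) (c : ℝ) :
    ∫ x, x ∂(mixture π ε c) = (1 - ε) * ∫ x, x ∂π + ε * c := by
  unfold mixture
  rw [integral_add_measure (hi.smul_measure (by simp))
      ((integrable_dirac (by simp)).smul_measure (by simp)),
    integral_smul_measure, integral_smul_measure, integral_dirac]
  simp [ENNReal.toReal_ofReal (by linarith [hε.2] : (0:ℝ) ≤ 1 - ε), ENNReal.toReal_ofReal hε.1]

/-- The coupled law stays in `ℳ₁(𝒳)` when `μ_X ∈ ℳ₁(𝒳)` and `c ∈ 𝒳` ("For `ε > 0` small enough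
we have `𝒟(Y) ∈ ℳ₁([a, ∞))` since `λ_Y > λ_X`"). [cite: JacobThiery2015, §3.1 (proof of
Lemma 3.1)] -/
theorem ae_mem_mixture {π : Measure ℝ} {X : Set ℝ} (hπ : ∀ᵐ x ∂π, x ∈ X) (ε : ℝ) {c : ℝ}
    (hc : c ∈ X) : ∀ᵐ x ∂(mixture π ε c), x ∈ X := by
  unfold mixture
  refine (ae_add_measure_iff).2 ⟨Measure.ae_smul_measure hπ _, Measure.ae_smul_measure ?_ _⟩
  rw [ae_dirac_eq]
  simpa using hc

/-! ## Product-measure lemmas -/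

/-- The law of `(U, X_0, …, X_{n−1})` under the input law is `ν ⊗ π^{⊗n}`.
[cite: JacobThiery2015, §2.2 (the marginals of `μ̌`)] -/
theorem inputLaw_map_restrict (ν : Measure S) [IsProbabilityMeasure ν] (π : Measure ℝ)
    [IsProbabilityMeasure π] (n : ℕ) :
    (inputLaw ν π).map (Prod.map id (Algorithm.restrictFin n)) =
      ν.prod (Measure.pi fun _ : Fin n => π) := by
  have hind : iIndepFun (fun (i : Fin n) (x : ℕ → ℝ) => x i.val)
      (Measure.infinitePi (fun _ : ℕ => π)) := by
    have h0 := iIndepFun_infinitePi (P := fun _ : ℕ => π) (X := fun _ (z : ℝ) => z)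
      (fun _ => measurable_id)
    exact h0.precomp Fin.val_injective
  have hlaw := hind.map_fun_eq_pi_map (fun i => (measurable_pi_apply (i.val)).aemeasurable)
  have hev : ∀ i : Fin n,
      (Measure.infinitePi (fun _ : ℕ => π)).map (fun x : ℕ → ℝ => x i.val) = π :=
    fun i => (measurePreserving_eval_infinitePi (fun _ : ℕ => π) i.val).map_eq
  simp only [hev] at hlaw
  unfold inputLaw
  rw [← Measure.map_prod_map _ _ measurable_id (Algorithm.measurable_restrictFin n),
    Measure.map_id]
  exact congrArg _ hlaw

/-- **The finite-dimensional coupling inequality**: `μ_Y^{⊗n} ≥ (1−ε)ⁿ μ_X^{⊗n}` — what the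
Bernoulli coupling computes ("`Ě(φ 1_{L_n ∩ M_n}) = (1−ε)ⁿ E(φ 1_{L_n})`", the event `M_n =
{B_1 = ⋯ = B_n = 1}` having probability `(1−ε)ⁿ` independently of `(U, X)`).
[cite: JacobThiery2015, §2.2 (eqbernoulli)] -/
theorem pi_smul_le_pi {π ρ : Measure ℝ} [IsFiniteMeasure π] [IsFiniteMeasure ρ] (a : ℝ≥0∞)
    (h : a • π ≤ ρ) :
    ∀ n : ℕ, a ^ n • Measure.pi (fun _ : Fin n => π) ≤ Measure.pi (fun _ : Fin n => ρ) := by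
  intro n
  induction n with
  | zero => rw [pow_zero, one_smul, Measure.pi_of_empty, Measure.pi_of_empty]
  | succ n IH =>
    have hπ := (measurePreserving_piFinSuccAbove (fun _ : Fin (n + 1) => π) 0).symm
      (MeasurableEquiv.piFinSuccAbove (fun _ => ℝ) 0)
    have hρ := (measurePreserving_piFinSuccAbove (fun _ : Fin (n + 1) => ρ) 0).symm
      (MeasurableEquiv.piFinSuccAbove (fun _ => ℝ) 0)
    rw [← hπ.map_eq, ← hρ.map_eq, ← Measure.map_smul]
    refine Measure.map_mono ?_ (MeasurableEquiv.measurable _)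
    calc a ^ (n + 1) • π.prod (Measure.pi fun _ : Fin n => π)
        = (a • π).prod (a ^ n • Measure.pi fun _ : Fin n => π) := by
          rw [Measure.prod_smul_right, Measure.prod_smul_left, smul_smul, pow_succ, mul_comm]
      _ ≤ ρ.prod (Measure.pi fun _ : Fin n => ρ) := Measure.prod_mono h IH

/-- `(1−ε)ⁿ μ_X^{⊗n} ≤ μ_Y^{⊗n}` for the printed mixture. [cite: JacobThiery2015, §2.2 (eqbernoulli)] -/
theorem pi_mixture_ge (π : Measure ℝ) [IsProbabilityMeasure π] {ε : ℝ} (hε : ε ∈ Icc (0 : ℝ) 1)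
    (c : ℝ) (n : ℕ) :
    ENNReal.ofReal (1 - ε) ^ n • Measure.pi (fun _ : Fin n => π) ≤
      Measure.pi (fun _ : Fin n => mixture π ε c) := by
  have := isProbabilityMeasure_mixture π hε c
  exact pi_smul_le_pi _ (smul_le_mixture π ε c) n

/-! ## The inequality chain (eqnonneg)–(eqbernoulli) and the limit (eqlimit) -/

namespace Algorithm

variable (A : Algorithm S) (ν : Measure S) [IsProbabilityMeasure ν]

/-- `E[φ_τ 1_{τ ≤ n}]` computed on the finite-dimensional law `ν ⊗ π^{⊗n}`.
[cite: JacobThiery2015, §2.2 (proof of Thm 2.1)] -/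
theorem lintegral_runBy_eq (π : Measure ℝ) [IsProbabilityMeasure π] (n : ℕ) :
    ∫⁻ p, A.runBy n p ∂(inputLaw ν π) =
      ∫⁻ q, A.runByFin n q ∂(ν.prod (Measure.pi fun _ : Fin n => π)) := by
  rw [← inputLaw_map_restrict ν π n,
    lintegral_map (A.measurable_runByFin n) (measurable_id.prodMap (measurable_restrictFin n))]
  exact lintegral_congr fun p => A.runBy_eq_comp_restrict n p

/-- **(eqnonneg) + (eqbernoulli)**: for `μ_Y = (1−ε)μ_X + ε δ_c` and every `n`,
`(1−ε)ⁿ E_{U,X}[φ_{τ_X} 1_{L_n}] ≤ E_{U,Y}[φ_{τ_Y}]`. [cite: JacobThiery2015, §2.2 (proof of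
Theorem 2.1, (eqnonneg) and (eqbernoulli))] -/
theorem lintegral_runBy_mixture_ge (π : Measure ℝ) [IsProbabilityMeasure π] {ε : ℝ}
    (hε : ε ∈ Icc (0 : ℝ) 1) (c : ℝ) (n : ℕ) :
    ENNReal.ofReal (1 - ε) ^ n * ∫⁻ p, A.runBy n p ∂(inputLaw ν π) ≤
      @lintegral _ _ (@inputLaw S _ ν (mixture π ε c) (isProbabilityMeasure_mixture π hε c))
        A.run := by
  have hY := isProbabilityMeasure_mixture π hε c
  calc ENNReal.ofReal (1 - ε) ^ n * ∫⁻ p, A.runBy n p ∂(inputLaw ν π)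
      = ENNReal.ofReal (1 - ε) ^ n *
          ∫⁻ q, A.runByFin n q ∂(ν.prod (Measure.pi fun _ : Fin n => π)) := by
        rw [A.lintegral_runBy_eq ν π n]
    _ = ∫⁻ q, A.runByFin n q ∂(ENNReal.ofReal (1 - ε) ^ n •
          (ν.prod (Measure.pi fun _ : Fin n => π))) := by
        rw [lintegral_smul_measure, smul_eq_mul]
    _ ≤ ∫⁻ q, A.runByFin n q ∂(ν.prod (Measure.pi fun _ : Fin n => mixture π ε c)) := by
        refine lintegral_mono' ?_ le_rfl
        rw [← Measure.prod_smul_right]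
        exact Measure.prod_mono le_rfl (pi_mixture_ge π hε c n)
    _ = ∫⁻ p, A.runBy n p ∂(inputLaw ν (mixture π ε c)) := (A.lintegral_runBy_eq ν _ n).symm
    _ ≤ ∫⁻ p, A.run p ∂(inputLaw ν (mixture π ε c)) := lintegral_mono fun p => A.runBy_le_run n p

/-- **(eqlimit)**: if `E[𝒜] < ∞` (in particular for a factory) the algorithm terminates almost
surely and `E[φ_τ 1_{L_n}] ↑ E[𝒜]` ("The dominated convergence theorem yields `lim_n E_{U,X}(φ_{τ_X}
1_{L_n}) = E_{U,X}(φ_{τ_X}) = f(λ_X)`"; here monotone convergence). [cite: JacobThiery2015, §2.2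
(proof of Theorem 2.1, (eqlimit))] -/
theorem iSup_lintegral_runBy {P : Measure (S × (ℕ → ℝ))} [IsFiniteMeasure P]
    (hfin : ∫⁻ p, A.run p ∂P ≠ ⊤) :
    ⨆ n, ∫⁻ p, A.runBy n p ∂P = ∫⁻ p, A.run p ∂P := by
  -- a.s. termination: `⊤ · P{τ = ∞} ≤ E[𝒜] < ∞`
  have hnull : P {p | ¬ A.Terminates p} = 0 := by
    by_contra hne
    apply hfin
    have h1 : ∫⁻ p, {p | ¬ A.Terminates p}.indicator (fun _ => (⊤ : ℝ≥0∞)) p ∂P ≤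
        ∫⁻ p, A.run p ∂P :=
      lintegral_mono fun p => by
        by_cases hp : A.Terminates p
        · simp [Set.indicator_of_notMem (show p ∉ {p | ¬ A.Terminates p} from fun h => h hp)]
        · simp [A.run_eq_top hp]
    have hs : MeasurableSet {p | ¬ A.Terminates p} := A.measurableSet_terminates.compl
    rw [lintegral_indicator_const hs, ENNReal.top_mul hne] at h1
    exact eq_top_iff.mpr h1
  rw [← lintegral_iSup (fun n => A.measurable_runBy n) (fun n m hnm p => A.runBy_mono p hnm)]
  simp_rw [A.iSup_runBy]
  refine lintegral_congr_ae ?_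
  filter_upwards [measure_eq_zero_iff_ae_notMem.mp hnull] with p hp
  exact Set.indicator_of_mem (show p ∈ {p | A.Terminates p} from not_not.mp hp) _

end Algorithm

/-! ## Theorem 2.1 and Lemma 2.1 -/

section Main

variable {ν : Measure S} [IsProbabilityMeasure ν] (A : Algorithm S)

/-- The analytic core behind Theorem 2.1 and Lemma 2.1: if the output of `𝒜` is an unbiased
estimator of `F(π) ∈ ℝ≥0∞` for the two laws `π = δ_{λ_X}` and `π = μ_Y(ε) = (1−ε)δ_{λ_X} + ε δ_{c_ε}`
(all small `ε`), with `F(δ_{λ_X}) < ∞`, then `F(δ_{λ_X}) ≤ liminf F(μ_Y(ε))`; here in the form used: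
a common value `v` of `E_{U,Y}[𝒜]` along `ε_m = 1/(m+2)` dominates `E_{U,X}[𝒜]`.
[cite: JacobThiery2015, §2.2 (proof of Theorem 2.1, last display: "`f(λ_Y) ≥ (1−ε)^{n_0}
(f(λ_X) − δ) > (1−ε)^{n_0}(f(λ_Y) + η)` … contradiction for `ε > 0` small enough")] -/
theorem lintegral_run_le_of_mixtures (lX : ℝ) (c : ℕ → ℝ) {v : ℝ≥0∞}
    (hX : ∫⁻ p, A.run p ∂(inputLaw ν (Measure.dirac lX)) ≠ ⊤)
    (hY : ∀ m : ℕ, @lintegral _ _ (@inputLaw S _ ν (mixture (Measure.dirac lX) (1 / (m + 2 : ℝ)) (c m))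
        (isProbabilityMeasure_mixture _ ⟨by positivity, by
          rw [div_le_one (by positivity)]; linarith⟩ (c m))) A.run = v) :
    ∫⁻ p, A.run p ∂(inputLaw ν (Measure.dirac lX)) ≤ v := by
  rw [← A.iSup_lintegral_runBy hX]
  refine iSup_le fun n => ?_
  -- for every `m`: `(1 − ε_m)ⁿ E_X[φ_τ 1_{L_n}] ≤ v`, and `(1 − ε_m)ⁿ → 1`
  have hεm : ∀ m : ℕ, (1 / (m + 2 : ℝ)) ∈ Icc (0 : ℝ) 1 := fun m =>
    ⟨by positivity, by rw [div_le_one (by positivity)]; linarith⟩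
  have hle : ∀ m : ℕ, ENNReal.ofReal (1 - 1 / (m + 2 : ℝ)) ^ n *
      ∫⁻ p, A.runBy n p ∂(inputLaw ν (Measure.dirac lX)) ≤ v := by
    intro m
    have h := A.lintegral_runBy_mixture_ge ν (Measure.dirac lX) (hεm m) (c m) n
    rwa [hY m] at h
  have hlim : Tendsto (fun m : ℕ => ENNReal.ofReal (1 - 1 / (m + 2 : ℝ)) ^ n *
      ∫⁻ p, A.runBy n p ∂(inputLaw ν (Measure.dirac lX))) atTop
      (𝓝 (1 ^ n * ∫⁻ p, A.runBy n p ∂(inputLaw ν (Measure.dirac lX)))) := by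
    refine ENNReal.Tendsto.mul_const (ENNReal.Tendsto.pow ?_) (Or.inl ?_)
    · rw [← ENNReal.ofReal_one]
      refine ENNReal.tendsto_ofReal ?_
      have h1 : Tendsto (fun m : ℕ => 1 / (m + 2 : ℝ)) atTop (𝓝 0) := by
        have := tendsto_one_div_add_atTop_nhds_zero_nat (𝕜 := ℝ)
        refine (tendsto_one_div_add_atTop_nhds_zero_nat.comp (tendsto_add_atTop_nat 1)).congr ?_
        intro m
        simp only [Function.comp]
        push_cast
        ring_nf
      simpa using (tendsto_const_nhds (x := (1 : ℝ))).sub h1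
    · simp
  rw [one_pow, one_mul] at hlim
  exact le_of_tendsto' hlim hle

variable {A} in
/-- The heart of the proofs of Theorem 2.1 and Lemma 3.1: an `f`-factory ON `𝒳` has
`f(λ_X) ≤ f(λ_Y)` whenever `λ_X ∈ 𝒳` and the coupling points `c_ε = ε⁻¹(λ_Y − λ_X(1−ε)) =
λ_X + (λ_Y − λ_X)/ε` (`ε = 1/(m+2)`) stay in `𝒳`.  Construction as printed: `μ_X = δ_{λ_X}`,
`μ_Y = (1−ε)μ_X + ε δ_{c_ε} ∈ ℳ₁(𝒳)` has mean `λ_Y`, and (eqnonneg)–(eqlimit) give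
`f(λ_Y) ≥ (1−ε)ⁿ E_X[φ_τ 1_{L_n}] → f(λ_X)`. [cite: JacobThiery2015, §2.2 (proof of Theorem 2.1)
and §3.1 (proof of Lemma 3.1: "One can then construct exactly the same contradiction")] -/
theorem IsFactoryOn.apply_le {X : Set ℝ} {f : ℝ → ℝ≥0} (hA : IsFactoryOn A ν X f) {lX lY : ℝ}
    (hlX : lX ∈ X) (hcX : ∀ m : ℕ, lX + (lY - lX) * (m + 2) ∈ X) : f lX ≤ f lY := by
  -- `μ_X = δ_{λ_X} ∈ ℳ₁(𝒳)`: mean `λ_X`, and `E_X[𝒜] = f(λ_X) < ∞`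
  have hiX : Integrable (fun x : ℝ => x) (Measure.dirac lX) := integrable_dirac (by simp)
  have hmX : ∫ x, x ∂(Measure.dirac lX) = lX := integral_dirac _ _
  have haX : ∀ᵐ x ∂(Measure.dirac lX), x ∈ X := by
    rw [ae_dirac_eq]
    simpa using hlX
  have hEX : ∫⁻ p, A.run p ∂(inputLaw ν (Measure.dirac lX)) = f lX := by
    rw [hA (Measure.dirac lX) hiX haX, hmX]
  -- `μ_Y(ε_m)`, `ε_m = 1/(m+2)`, `c_m = ε_m⁻¹ (λ_Y − λ_X (1 − ε_m)) = λ_X + (λ_Y − λ_X)(m+2) ∈ 𝒳`: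
  -- mean `λ_Y`, `E_Y[𝒜] = f(λ_Y)`
  set c : ℕ → ℝ := fun m => lX + (lY - lX) * (m + 2) with hc
  have hεm : ∀ m : ℕ, (1 / (m + 2 : ℝ)) ∈ Icc (0 : ℝ) 1 := fun m =>
    ⟨by positivity, by rw [div_le_one (by positivity)]; linarith⟩
  have hEY : ∀ m : ℕ, @lintegral _ _ (@inputLaw S _ ν (mixture (Measure.dirac lX)
      (1 / (m + 2 : ℝ)) (c m)) (isProbabilityMeasure_mixture _ (hεm m) (c m))) A.run = f lY := by
    intro m
    have hP := isProbabilityMeasure_mixture (Measure.dirac lX) (hεm m) (c m)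
    have h := @hA (mixture (Measure.dirac lX) (1 / (m + 2 : ℝ)) (c m)) hP
      (integrable_mixture hiX _ _) (ae_mem_mixture haX _ (hcX m))
    rw [h, integral_mixture hiX (hεm m), hmX]
    have hne : (m + 2 : ℝ) ≠ 0 := by positivity
    have e : (1 - 1 / (m + 2 : ℝ)) * lX + 1 / (m + 2 : ℝ) * c m = lY := by
      simp only [hc]
      field_simp
      ring
    rw [e]
  have key := lintegral_run_le_of_mixtures A lX c (by rw [hEX]; exact ENNReal.coe_ne_top) hEY
  rw [hEX] at key
  exact_mod_cast key

/-- **An `f`-factory has `f(λ_X) ≤ f(λ_Y)` for every pair of reals** (hence `f` is constant):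
on `𝒳 = ℝ` the coupling points are unconstrained. [cite: JacobThiery2015, §2.2 (proof of
Theorem 2.1)] -/
theorem IsFactory.apply_le {f : ℝ → ℝ≥0} (hA : IsFactory A ν f) (lX lY : ℝ) : f lX ≤ f lY :=
  (hA.isFactoryOn Set.univ).apply_le (Set.mem_univ _) fun _ => Set.mem_univ _

/-- **THEOREM 2.1** (Jacob–Thiery): "For any nonconstant function `f : ℝ → ℝ⁺`, no `f`-factory
exists" — an algorithm whose output is, for every input law `π ∈ ℳ₁(ℝ)`, a non-negative unbiased
estimator of `f(m₁(π))` can only exist for CONSTANT `f`. [cite: JacobThiery2015, §2.2 Theorem 2.1] -/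
theorem JacobThiery2015_thm_2_1 {f : ℝ → ℝ≥0} (hA : IsFactory A ν f) (a b : ℝ) : f a = f b :=
  le_antisymm (IsFactory.apply_le A hA a b) (IsFactory.apply_le A hA b a)

/-- THEOREM 2.1, as printed: a non-constant `f` admits no `f`-factory.
[cite: JacobThiery2015, §2.2 Theorem 2.1] -/
theorem JacobThiery2015_thm_2_1' {f : ℝ → ℝ≥0} (hf : ∃ a b, f a ≠ f b) : ¬ IsFactory A ν f :=
  fun hA => by obtain ⟨a, b, hab⟩ := hf; exact hab (JacobThiery2015_thm_2_1 A hA a b)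

/-- In particular neither `exp(λ)` nor any other non-constant function of `λ` can be estimated
without sign and without bias from unbiased estimates of `λ` ("we cannot obtain `U⁺`-estimators of
neither `exp(λ)` nor `1/λ`"). [cite: JacobThiery2015, §2.2 (paragraph after the proof of
Theorem 2.1)] -/
theorem not_isFactory_exp : ¬ IsFactory A ν (fun x => ⟨Real.exp x, (Real.exp_pos x).le⟩) :=
  JacobThiery2015_thm_2_1' A ⟨0, 1, fun h => by
    have h2 : Real.exp 0 = Real.exp 1 := congrArg (fun z : ℝ≥0 => (z : ℝ)) h
    exact absurd (Real.exp_injective h2) zero_ne_one⟩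

/-- **LEMMA 2.1** (Jacob–Thiery): "Let `η ≥ 0` be a known constant.  There does not exist an
algorithm `𝒜` such that for any independent sequence `X = (X_n)` marginally distributed as
`π ∈ ℳ₁(ℝ)` with `m₁(π) > η` and an auxiliary random variable `U` … independent from `(X_n)`, the
random variable `Y = 𝒜(U, X)` is a nonnegative unbiased estimator of `m₁(π)`" — even knowing
`λ > η`, `λ` cannot be re-estimated without sign and without bias.  Proof as printed: the same
coupling with `λ_X = η + 2 > λ_Y = η + 1 > η`. [cite: JacobThiery2015, §2.2 Lemma 2.1] -/
theorem JacobThiery2015_lemma_2_1 (η : ℝ) (hη : 0 ≤ η) :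
    ¬ (∀ (π : Measure ℝ) [IsProbabilityMeasure π], Integrable (fun x : ℝ => x) π →
        η < ∫ x, x ∂π → ∫⁻ p, A.run p ∂(inputLaw ν π) = ENNReal.ofReal (∫ x, x ∂π)) := by
  intro hA
  -- `λ_X = η + 2 > λ_Y = η + 1 > η`
  have hiX : Integrable (fun x : ℝ => x) (Measure.dirac (η + 2)) := integrable_dirac (by simp)
  have hmX : ∫ x, x ∂(Measure.dirac (η + 2)) = η + 2 := integral_dirac _ _
  have hEX : ∫⁻ p, A.run p ∂(inputLaw ν (Measure.dirac (η + 2))) = ENNReal.ofReal (η + 2) := by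
    rw [hA (Measure.dirac (η + 2)) hiX (by rw [hmX]; linarith), hmX]
  set c : ℕ → ℝ := fun m => ((η + 1) - (η + 2) * (1 - 1 / (m + 2 : ℝ))) / (1 / (m + 2 : ℝ))
    with hc
  have hεm : ∀ m : ℕ, (1 / (m + 2 : ℝ)) ∈ Icc (0 : ℝ) 1 := fun m =>
    ⟨by positivity, by rw [div_le_one (by positivity)]; linarith⟩
  have hmY : ∀ m : ℕ, ∫ x, x ∂(mixture (Measure.dirac (η + 2)) (1 / (m + 2 : ℝ)) (c m)) = η + 1 := by
    intro m
    have hP := isProbabilityMeasure_mixture (Measure.dirac (η + 2)) (hεm m) (c m)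
    rw [integral_mixture hiX (hεm m), hmX]
    have hne : (1 / (m + 2 : ℝ)) ≠ 0 := by positivity
    simp only [hc]
    field_simp
    ring
  have hEY : ∀ m : ℕ, @lintegral _ _ (@inputLaw S _ ν (mixture (Measure.dirac (η + 2))
      (1 / (m + 2 : ℝ)) (c m)) (isProbabilityMeasure_mixture _ (hεm m) (c m))) A.run =
      ENNReal.ofReal (η + 1) := by
    intro m
    have hP := isProbabilityMeasure_mixture (Measure.dirac (η + 2)) (hεm m) (c m)
    have h := @hA (mixture (Measure.dirac (η + 2)) (1 / (m + 2 : ℝ)) (c m)) hP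
      (integrable_mixture hiX _ _) (by rw [hmY m]; linarith)
    rw [h, hmY m]
  have key := lintegral_run_le_of_mixtures A (η + 2) c (by rw [hEX]; exact ENNReal.ofReal_ne_top) hEY
  rw [hEX] at key
  have : η + 2 ≤ η + 1 := (ENNReal.ofReal_le_ofReal_iff (by linarith)).mp key
  linarith

/-- Non-vacuity of Definition 2 / sharpness of Theorem 2.1: CONSTANT functions do have factories —
stop at once and output the constant. [cite: JacobThiery2015, §2.2 Theorem 2.1 ("nonconstant" is
needed)] -/
def constAlgorithm (S : Type*) [MeasurableSpace S] (c : ℝ≥0) : Algorithm S where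
  stop := fun _ _ => true
  out := fun _ _ => c
  measurable_stop := fun _ => measurable_const
  measurable_out := fun _ => measurable_const
  stop_adapted := fun _ _ _ _ _ => rfl
  out_adapted := fun _ _ _ _ _ => rfl

/-- The constant algorithm is a `(fun _ => c)`-factory. [cite: JacobThiery2015, §2.2 Theorem 2.1] -/
theorem isFactory_const (c : ℝ≥0) : IsFactory (constAlgorithm S c) ν (fun _ => c) := by
  intro π hπ _
  have hstop : ∀ p : S × (ℕ → ℝ), (constAlgorithm S c).stopped 0 p := fun p =>
    ⟨rfl, fun j hj => absurd hj (Nat.not_lt_zero j)⟩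
  have hrun : ∀ p, (constAlgorithm S c).run p = c := fun p =>
    (constAlgorithm S c).run_eq_of_stopped (hstop p)
  simp_rw [hrun]
  rw [lintegral_const, measure_univ, mul_one]

/-! ## §3.1, Lemma 3.1: on a half-line a factory forces monotonicity -/

variable {A} in
/-- **LEMMA 3.1, first assertion** (Jacob–Thiery): "For an `f`-factory to exist with `𝒳 = [a, ∞)`
and `f : 𝒳 → ℝ⁺`, `f` must be increasing" — in the weak sense: `λ_X ≤ λ_Y` in `[a, ∞)` implies
`f(λ_X) ≤ f(λ_Y)` (constants have factories, `isFactory_const`).  Proof as printed: the coupling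
of Theorem 2.1 with `a ≤ λ_X < λ_Y`, whose laws stay in `ℳ₁([a, ∞))`.
[cite: JacobThiery2015, §3.1 Lemma 3.1] -/
theorem JacobThiery2015_lemma_3_1_Ici {a : ℝ} {f : ℝ → ℝ≥0} (hA : IsFactoryOn A ν (Set.Ici a) f) :
    MonotoneOn f (Set.Ici a) := by
  intro lX hlX lY _ hle
  refine hA.apply_le hlX fun m => ?_
  rw [Set.mem_Ici] at hlX ⊢
  have hm : (0 : ℝ) ≤ m + 2 := by positivity
  exact hlX.trans (le_add_of_nonneg_right (mul_nonneg (sub_nonneg.2 hle) hm))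

variable {A} in
/-- **LEMMA 3.1, second assertion** (Jacob–Thiery): "For a `g`-factory to exist with
`𝒳 = (−∞, b]` and `g : 𝒳 → ℝ⁺`, `g` must be decreasing" (weakly) — "By symmetry": the coupling
with `λ_Y < λ_X ≤ b` pushes the Dirac part to the left.
[cite: JacobThiery2015, §3.1 Lemma 3.1] -/
theorem JacobThiery2015_lemma_3_1_Iic {b : ℝ} {g : ℝ → ℝ≥0} (hA : IsFactoryOn A ν (Set.Iic b) g) :
    AntitoneOn g (Set.Iic b) := by
  intro lX _ lY hlY hle
  refine hA.apply_le hlY fun m => ?_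
  rw [Set.mem_Iic] at hlY ⊢
  have hm : (0 : ℝ) ≤ m + 2 := by positivity
  have h0 : 0 ≤ (lY - lX) * (m + 2) := mul_nonneg (sub_nonneg.2 hle) hm
  have h1 : lY + (lX - lY) * (m + 2) = lY - (lY - lX) * (m + 2) := by ring
  rw [h1]
  linarith [h0, hlY]

/-- "Lemma 3.1 indicates in particular that it is impossible to obtain `U⁺`-estimators of `1/λ`
given `U⁺`-estimators of a quantity `λ > 0`": on `𝒳 = [a, ∞)`, `a > 0`, the (non-monotone)
function `x ↦ 1/x` has no factory. [cite: JacobThiery2015, §3.1 (paragraph after Lemma 3.1)] -/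
theorem not_isFactoryOn_inv {a : ℝ} (ha : 0 < a) :
    ¬ IsFactoryOn A ν (Set.Ici a) (fun x => Real.toNNReal x⁻¹) := by
  intro hA
  have h := JacobThiery2015_lemma_3_1_Ici hA (Set.mem_Ici.2 le_rfl)
    (Set.mem_Ici.2 (by linarith) : a + 1 ∈ Set.Ici a) (by linarith : a ≤ a + 1)
  have h' : a⁻¹ ≤ (a + 1)⁻¹ :=
    (Real.toNNReal_le_toNNReal_iff (by positivity : (0 : ℝ) ≤ (a + 1)⁻¹)).mp h
  exact absurd h' (not_le.2 (inv_strictAnti₀ ha (by linarith)))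

end Main

/-! ## §3.1: power-series factories on `[a, ∞)` and the Poisson estimator -/

section Series

/-- The partial sums `Y_n = Σ_{j=0}^{n} w_j c_j ∏_{k<j} (x_k − a)` of the power-series estimator
("`Y = Σ_{n=0}^{N} w_n c_n ∏_{k=1}^{n} (X_k − a)`, where the product is equal to `1` when
`n = 0`"). [cite: JacobThiery2015, §3.1 (display after (eqfanalytic))] -/
def seriesSum (a : ℝ) (c w : ℕ → ℝ) (n : ℕ) (x : ℕ → ℝ) : ℝ :=
  ∑ j ∈ range (n + 1), w j * c j * ∏ k ∈ range j, (x k - a)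

/-- The coordinates `x ↦ x_k` are measurable. [cite: JacobThiery2015, §2.1 Definition 1] -/
theorem measurable_coord (k : ℕ) : Measurable fun x : ℕ → ℝ => x k := measurable_pi_apply k

/-- `Y_n` is a measurable function of the inputs. [cite: JacobThiery2015, §3.1] -/
theorem measurable_seriesSum (a : ℝ) (c w : ℕ → ℝ) (n : ℕ) : Measurable (seriesSum a c w n) := by
  unfold seriesSum
  refine Finset.measurable_sum _ fun j _ => ?_
  exact (Finset.measurable_prod _ fun k _ => (measurable_coord k).sub_const a).const_mul _

/-- `Y_n` reads only `x_0, …, x_{n−1}`. [cite: JacobThiery2015, §3.1] -/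
theorem seriesSum_congr (a : ℝ) (c w : ℕ → ℝ) {n : ℕ} {x y : ℕ → ℝ} (h : ∀ k < n, x k = y k) :
    seriesSum a c w n x = seriesSum a c w n y := by
  refine Finset.sum_congr rfl fun j hj => ?_
  rw [Finset.prod_congr rfl fun k hk => by
    rw [h k (lt_of_lt_of_le (mem_range.1 hk) (Nat.lt_succ_iff.1 (mem_range.1 hj)))]]

/-- "almost surely nonnegative": `Y_n ≥ 0` whenever all inputs lie in `[a, ∞)` and `c_j, w_j ≥ 0`.
[cite: JacobThiery2015, §3.1] -/
theorem seriesSum_nonneg {a : ℝ} {c w : ℕ → ℝ} (hc : ∀ j, 0 ≤ c j) (hw : ∀ j, 0 ≤ w j)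
    {x : ℕ → ℝ} (hx : ∀ k, a ≤ x k) (n : ℕ) : 0 ≤ seriesSum a c w n x :=
  Finset.sum_nonneg fun j _ => mul_nonneg (mul_nonneg (hw j) (hc j))
    (Finset.prod_nonneg fun k _ => sub_nonneg.2 (hx k))

/-- **The power-series algorithm**: auxiliary variable `N ∈ ℕ`; stop after reading `N` inputs and
output `Y = Y_N = Σ_{n ≤ N} w_n c_n ∏_{k<n} (X_k − a)` (its positive part, which is `Y` itself on
`[a, ∞)`-valued inputs — `seriesAlgorithm_run`, `seriesSum_nonneg`).
[cite: JacobThiery2015, §3.1 (construction after (eqfanalytic))] -/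
def seriesAlgorithm (a : ℝ) (c w : ℕ → ℝ) : Algorithm ℕ where
  stop := fun n p => decide (p.1 = n)
  out := fun n p => Real.toNNReal (seriesSum a c w n p.2)
  measurable_stop := fun n =>
    (measurable_from_nat (f := fun u : ℕ => decide (u = n))).comp measurable_fst
  measurable_out := fun n =>
    measurable_real_toNNReal.comp ((measurable_seriesSum a c w n).comp measurable_snd)
  stop_adapted := fun _ _ _ _ _ => rfl
  out_adapted := fun n u x y h => by
    show Real.toNNReal (seriesSum a c w n x) = Real.toNNReal (seriesSum a c w n y)
    rw [seriesSum_congr a c w h]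

/-- The power-series algorithm stops exactly after `N` inputs. [cite: JacobThiery2015, §3.1] -/
theorem seriesAlgorithm_stopped (a : ℝ) (c w : ℕ → ℝ) (p : ℕ × (ℕ → ℝ)) :
    (seriesAlgorithm a c w).stopped p.1 p := by
  refine ⟨by simp [seriesAlgorithm], fun j hj => ?_⟩
  simp [seriesAlgorithm, Nat.ne_of_gt hj]

/-- Its output is `Y⁺ = max(Y, 0)` with `Y = Y_N`. [cite: JacobThiery2015, §3.1] -/
theorem seriesAlgorithm_run (a : ℝ) (c w : ℕ → ℝ) (p : ℕ × (ℕ → ℝ)) :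
    (seriesAlgorithm a c w).run p = ENNReal.ofReal (seriesSum a c w p.1 p.2) := by
  rw [(seriesAlgorithm a c w).run_eq_of_stopped (seriesAlgorithm_stopped a c w p)]
  rfl

/-- The debiasing weights `w_n = 1 / P(N ≥ n)` of the law `ν` of `N`.
[cite: JacobThiery2015, §3.1 ("setting the weights `w_n = 1/P(N ≥ n)` as in Section 1.2")] -/
def debiasWeight (ν : Measure ℕ) (n : ℕ) : ℝ := ((ν (Set.Ici n)).toReal)⁻¹

/-- `w_n ≥ 0`. [cite: JacobThiery2015, §3.1] -/
theorem debiasWeight_nonneg (ν : Measure ℕ) (n : ℕ) : 0 ≤ debiasWeight ν n :=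
  inv_nonneg.2 ENNReal.toReal_nonneg

/-- `w_n · P(N ≥ n) = 1` when `N` "can take arbitrarily large values" (`P(N ≥ n) > 0`).
[cite: JacobThiery2015, §1.2 / §3.1] -/
theorem ofReal_debiasWeight_mul (ν : Measure ℕ) [IsFiniteMeasure ν] {n : ℕ}
    (hν : ν (Set.Ici n) ≠ 0) : ENNReal.ofReal (debiasWeight ν n) * ν (Set.Ici n) = 1 := by
  have ht : ν (Set.Ici n) ≠ ⊤ := measure_ne_top ν _
  rw [debiasWeight, ENNReal.ofReal_inv_of_pos (ENNReal.toReal_pos hν ht), ENNReal.ofReal_toReal ht,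
    ENNReal.inv_mul_cancel hν ht]

/-- Tonelli over the law of `N`: `Σ_u P(N = u) Σ_{j ≤ u} g_j = Σ_j g_j P(N ≥ j)`.
[cite: JacobThiery2015, §3.1 ("Tonelli's theorem yields …")] -/
theorem tsum_sum_range_mul_measure_singleton (ν : Measure ℕ) (g : ℕ → ℝ≥0∞) :
    ∑' u, (∑ j ∈ range (u + 1), g j) * ν {u} = ∑' j, g j * ν (Set.Ici j) := by
  have h1 : ∀ u, (∑ j ∈ range (u + 1), g j) * ν {u} =
      ∑' j, (Set.Ici j).indicator (fun u => g j * ν {u}) u := by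
    intro u
    rw [Finset.sum_mul, sum_eq_tsum_indicator]
    refine tsum_congr fun j => ?_
    by_cases h : j ≤ u
    · rw [Set.indicator_of_mem (Finset.mem_coe.2 (mem_range.2 (Nat.lt_succ_of_le h))),
        Set.indicator_of_mem (Set.mem_Ici.2 h)]
    · rw [Set.indicator_of_notMem
          (fun hm => h (Nat.le_of_lt_succ (mem_range.1 (Finset.mem_coe.1 hm)))),
        Set.indicator_of_notMem (fun hm => h (Set.mem_Ici.1 hm))]
  simp_rw [h1]
  rw [ENNReal.tsum_comm]
  refine tsum_congr fun j => ?_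
  have h2 : ∀ u, (Set.Ici j).indicator (fun u => g j * ν {u}) u =
      g j * (Set.Ici j).indicator (fun u => ν {u}) u := fun u => by
    by_cases h : u ∈ Set.Ici j
    · rw [Set.indicator_of_mem h, Set.indicator_of_mem h]
    · rw [Set.indicator_of_notMem h, Set.indicator_of_notMem h, mul_zero]
  simp_rw [h2]
  rw [ENNReal.tsum_mul_left, Measure.tsum_indicator_apply_singleton _ _ measurableSet_Ici]

variable (π : Measure ℝ) [IsProbabilityMeasure π]

/-- Under `π^{⊗ℕ}` with `π ∈ ℳ₁([a, ∞))`, all inputs lie in `[a, ∞)` almost surely.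
[cite: JacobThiery2015, §3.1] -/
theorem ae_forall_le_infinitePi {a : ℝ} (hX : ∀ᵐ y ∂π, y ∈ Set.Ici a) :
    ∀ᵐ x ∂(Measure.infinitePi fun _ : ℕ => π), ∀ k, a ≤ x k := by
  rw [ae_all_iff]
  intro k
  exact (measurePreserving_eval_infinitePi (fun _ : ℕ => π) k).quasiMeasurePreserving.ae hX

/-- `E[∏_{k<j} (X_k − a)] = (m₁(π) − a)^j` for i.i.d. `X_k ∼ π ∈ ℳ₁([a, ∞))` ("the identity
`E[X × Y] = E[X] × E[Y]` for `X` independent from `Y`").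
[cite: JacobThiery2015, §3.1 (the stability discussion after (eqfanalytic))] -/
theorem lintegral_prod_sub_eq {a : ℝ} (hi : Integrable (fun x : ℝ => x) π)
    (hX : ∀ᵐ y ∂π, y ∈ Set.Ici a) (j : ℕ) :
    ∫⁻ x, ∏ k ∈ range j, ENNReal.ofReal (x k - a) ∂(Measure.infinitePi fun _ : ℕ => π) =
      ENNReal.ofReal (∫ y, y ∂π - a) ^ j := by
  have hmeas : Measurable fun z : ℝ => ENNReal.ofReal (z - a) :=
    (measurable_id.sub_const a).ennreal_ofReal
  have hind : iIndepFun (fun (k : ℕ) (x : ℕ → ℝ) => ENNReal.ofReal (x k - a))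
      (Measure.infinitePi fun _ : ℕ => π) :=
    iIndepFun_infinitePi (P := fun _ : ℕ => π) (X := fun _ (z : ℝ) => ENNReal.ofReal (z - a))
      (fun _ => hmeas)
  have hprod := lintegral_prod_eq_prod_lintegral_of_indepFun (range j)
    (fun (k : ℕ) (x : ℕ → ℝ) => ENNReal.ofReal (x k - a)) hind
    (fun k => ((measurable_coord k).sub_const a).ennreal_ofReal)
  -- `E[X_k − a] = ∫ (y − a) dπ = m₁(π) − a ≥ 0`
  have hi' : Integrable (fun y : ℝ => y - a) π := hi.sub (integrable_const a)
  have hnn : 0 ≤ᵐ[π] fun y : ℝ => y - a := hX.mono fun y hy => sub_nonneg.2 (Set.mem_Ici.1 hy)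
  have hc : ∫ y, y - a ∂π = ∫ y, y ∂π - a := by
    rw [integral_sub hi (integrable_const a), integral_const]
    simp
  have hk : ∀ k : ℕ, ∫⁻ x, ENNReal.ofReal (x k - a) ∂(Measure.infinitePi fun _ : ℕ => π) =
      ENNReal.ofReal (∫ y, y ∂π - a) := by
    intro k
    have h1 : ∫⁻ x, ENNReal.ofReal (x k - a) ∂(Measure.infinitePi fun _ : ℕ => π) =
        ∫⁻ z, ENNReal.ofReal (z - a) ∂π :=
      (measurePreserving_eval_infinitePi (fun _ : ℕ => π) k).lintegral_comp hmeas
    rw [h1, ← ofReal_integral_eq_lintegral_ofReal hi' hnn, hc]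
  rw [hprod]
  simp_rw [hk, Finset.prod_const, Finset.card_range]

/-- `E[Y_u⁺] = E[Y_u] = Σ_{j ≤ u} w_j c_j (m₁(π) − a)^j` for inputs in `ℳ₁([a, ∞))`
("Tonelli's theorem"). [cite: JacobThiery2015, §3.1] -/
theorem lintegral_seriesSum_eq {a : ℝ} {c w : ℕ → ℝ} (hc : ∀ j, 0 ≤ c j) (hw : ∀ j, 0 ≤ w j)
    (hi : Integrable (fun x : ℝ => x) π) (hX : ∀ᵐ y ∂π, y ∈ Set.Ici a) (u : ℕ) :
    ∫⁻ x, ENNReal.ofReal (seriesSum a c w u x) ∂(Measure.infinitePi fun _ : ℕ => π) =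
      ∑ j ∈ range (u + 1), ENNReal.ofReal (w j * c j) * ENNReal.ofReal (∫ y, y ∂π - a) ^ j := by
  have hm : ∀ j, Measurable fun x : ℕ → ℝ => ∏ k ∈ range j, ENNReal.ofReal (x k - a) := fun j =>
    Finset.measurable_prod _ fun k _ => ((measurable_coord k).sub_const a).ennreal_ofReal
  calc ∫⁻ x, ENNReal.ofReal (seriesSum a c w u x) ∂(Measure.infinitePi fun _ : ℕ => π)
      = ∫⁻ x, ∑ j ∈ range (u + 1), ENNReal.ofReal (w j * c j) *
          ∏ k ∈ range j, ENNReal.ofReal (x k - a) ∂(Measure.infinitePi fun _ : ℕ => π) := by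
        refine lintegral_congr_ae ((ae_forall_le_infinitePi π hX).mono fun x hx => ?_)
        simp only [seriesSum]
        rw [ENNReal.ofReal_sum_of_nonneg fun j _ => mul_nonneg (mul_nonneg (hw j) (hc j))
          (Finset.prod_nonneg fun k _ => sub_nonneg.2 (hx k))]
        refine Finset.sum_congr rfl fun j _ => ?_
        rw [ENNReal.ofReal_mul (mul_nonneg (hw j) (hc j)),
          ENNReal.ofReal_prod_of_nonneg fun k _ => sub_nonneg.2 (hx k)]
    _ = ∑ j ∈ range (u + 1), ENNReal.ofReal (w j * c j) *
          ∫⁻ x, ∏ k ∈ range j, ENNReal.ofReal (x k - a) ∂(Measure.infinitePi fun _ : ℕ => π) := by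
        rw [lintegral_finsetSum _ fun j _ => (hm j).const_mul _]
        exact Finset.sum_congr rfl fun j _ => lintegral_const_mul _ (hm j)
    _ = ∑ j ∈ range (u + 1), ENNReal.ofReal (w j * c j) * ENNReal.ofReal (∫ y, y ∂π - a) ^ j := by
        simp_rw [lintegral_prod_sub_eq π hi hX]

/-- **Existence of `f`-factories on `[a, ∞)` for power series with non-negative coefficients**
("there exists an `f`-factory for any function `f : [a, ∞) → ℝ⁺` that can be expressed as a power
series `f(x) = Σ_{n≥0} c_n (x − a)^n` with `c_n ≥ 0` … Tonelli's theorem yields that the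
estimator `Y = Σ_{n=0}^{N} w_n c_n ∏_{k=1}^{n} (X_k − a)` … is well defined, is almost surely
nonnegative and has expectation `f(m₁(μ_X))`"; i.e. `𝓕 ⊆ 𝓒`), for EVERY law `ν` of `N` with
`P(N ≥ n) > 0` for all `n` and `w_n = 1/P(N ≥ n)`.
[cite: JacobThiery2015, §3.1 (eqfanalytic) and the construction following it] -/
theorem isFactoryOn_seriesAlgorithm (ν : Measure ℕ) [IsProbabilityMeasure ν]
    (hν : ∀ n, ν (Set.Ici n) ≠ 0) {a : ℝ} {c : ℕ → ℝ} (hc : ∀ n, 0 ≤ c n) {f : ℝ → ℝ≥0}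
    (hf : ∀ x, a ≤ x → HasSum (fun n => c n * (x - a) ^ n) (f x : ℝ)) :
    IsFactoryOn (seriesAlgorithm a c (debiasWeight ν)) ν (Set.Ici a) f := by
  intro π _ hi hX
  -- `m₁(π) ≥ a`
  have hma : a ≤ ∫ y, y ∂π := by
    have h := integral_mono_ae (integrable_const a) hi
      (hX.mono fun y hy => (Set.mem_Ici.1 hy : a ≤ y))
    simpa using h
  -- `E[𝒜] = Σ_u P(N = u) E[Y_u⁺]` (Tonelli on `ν ⊗ π^{⊗ℕ}`, then the countable state space)
  have hmeas : Measurable fun p : ℕ × (ℕ → ℝ) =>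
      ENNReal.ofReal (seriesSum a c (debiasWeight ν) p.1 p.2) := by
    have h := (seriesAlgorithm a c (debiasWeight ν)).measurable_run
    have e : (seriesAlgorithm a c (debiasWeight ν)).run =
        fun p => ENNReal.ofReal (seriesSum a c (debiasWeight ν) p.1 p.2) :=
      funext fun p => seriesAlgorithm_run a c _ p
    rwa [e] at h
  unfold inputLaw
  simp_rw [seriesAlgorithm_run]
  rw [lintegral_prod _ hmeas.aemeasurable, lintegral_countable']
  simp_rw [lintegral_seriesSum_eq π hc (debiasWeight_nonneg ν) hi hX,
    tsum_sum_range_mul_measure_singleton]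
  -- `w_j P(N ≥ j) = 1`
  have hterm : ∀ j, ENNReal.ofReal (debiasWeight ν j * c j) * ENNReal.ofReal (∫ y, y ∂π - a) ^ j *
      ν (Set.Ici j) = ENNReal.ofReal (c j * (∫ y, y ∂π - a) ^ j) := by
    intro j
    rw [ENNReal.ofReal_mul (debiasWeight_nonneg ν j), ENNReal.ofReal_mul (hc j),
      ENNReal.ofReal_pow (sub_nonneg.2 hma)]
    calc ENNReal.ofReal (debiasWeight ν j) * ENNReal.ofReal (c j) *
          ENNReal.ofReal (∫ y, y ∂π - a) ^ j * ν (Set.Ici j)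
        = (ENNReal.ofReal (debiasWeight ν j) * ν (Set.Ici j)) *
            (ENNReal.ofReal (c j) * ENNReal.ofReal (∫ y, y ∂π - a) ^ j) := by ring
      _ = ENNReal.ofReal (c j) * ENNReal.ofReal (∫ y, y ∂π - a) ^ j := by
          rw [ofReal_debiasWeight_mul ν (hν j), one_mul]
  simp_rw [hterm]
  rw [← ENNReal.ofReal_tsum_of_nonneg (fun j => mul_nonneg (hc j) (pow_nonneg (sub_nonneg.2 hma) j))
      (hf _ hma).summable, (hf _ hma).tsum_eq, ENNReal.ofReal_coe_nnreal]

/-- **The Poisson estimator**: "a construction of a Poisson estimator, that is, an estimator of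
`λ = exp(E[X])` given a stream `(X_n)` of i.i.d. `[a, +∞)`-valued random variables … the
exponential function can be expressed as in (eqfanalytic) with `c_n = exp(a)/n!`" — so `exp`,
which has NO factory on `𝒳 = ℝ` (`not_isFactory_exp`), has one on every half-line `[a, ∞)`.
[cite: JacobThiery2015, §3.1 (the Poisson estimator)] -/
theorem isFactoryOn_exp (ν : Measure ℕ) [IsProbabilityMeasure ν] (hν : ∀ n, ν (Set.Ici n) ≠ 0)
    (a : ℝ) :
    IsFactoryOn (seriesAlgorithm a (fun n => Real.exp a / n.factorial) (debiasWeight ν)) ν (Set.Ici a)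
      (fun x => ⟨Real.exp x, (Real.exp_pos x).le⟩) := by
  refine isFactoryOn_seriesAlgorithm ν hν (fun n => by positivity) fun x _ => ?_
  have h := NormedSpace.expSeries_div_hasSum_exp (x - a)
  rw [← congr_fun Real.exp_eq_exp_ℝ (x - a)] at h
  have h2 := h.mul_left (Real.exp a)
  have h3 : Real.exp a * Real.exp (x - a) = Real.exp x := by
    rw [← Real.exp_add]
    congr 1
    ring
  rw [h3] at h2
  have e : (fun n : ℕ => Real.exp a / (n.factorial : ℝ) * (x - a) ^ n) =
      fun n : ℕ => Real.exp a * ((x - a) ^ n / (n.factorial : ℝ)) := funext fun n => by ring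
  rw [e]
  exact h2

/-- `Y = Y_N` is a (jointly) measurable function of `(N, X)`. [cite: JacobThiery2015, §3.1] -/
theorem measurable_seriesSum_uncurry (a : ℝ) (c w : ℕ → ℝ) :
    Measurable fun p : ℕ × (ℕ → ℝ) => seriesSum a c w p.1 p.2 :=
  measurable_from_prod_countable_right (f := fun p : ℕ × (ℕ → ℝ) => seriesSum a c w p.1 p.2)
    fun u => measurable_seriesSum a c w u

/-- "is almost surely nonnegative": `Y = Σ_{n ≤ N} w_n c_n ∏_{k<n} (X_k − a) ≥ 0` a.s. under
`ν ⊗ π^{⊗ℕ}`, `π ∈ ℳ₁([a, ∞))`, `c_n, w_n ≥ 0`. [cite: JacobThiery2015, §3.1] -/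
theorem seriesSum_ae_nonneg (ν : Measure ℕ) [IsProbabilityMeasure ν] {a : ℝ} {c w : ℕ → ℝ}
    (hc : ∀ j, 0 ≤ c j) (hw : ∀ j, 0 ≤ w j) (hX : ∀ᵐ y ∂π, y ∈ Set.Ici a) :
    ∀ᵐ p ∂(inputLaw ν π), 0 ≤ seriesSum a c w p.1 p.2 := by
  unfold inputLaw
  have h2 : ∀ᵐ p ∂(ν.prod (Measure.infinitePi fun _ : ℕ => π)), ∀ k, a ≤ p.2 k :=
    Measure.quasiMeasurePreserving_snd.ae (ae_forall_le_infinitePi π hX)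
  exact h2.mono fun p hp => seriesSum_nonneg hc hw hp _

/-- "has expectation `f(m₁(μ_X))`": the printed estimator `Y` ITSELF (a real random variable, equal
to the algorithm's output `Y⁺` almost surely) is an unbiased estimator of `f(m₁(π))` for every
`π ∈ ℳ₁([a, ∞))` with finite first moment. [cite: JacobThiery2015, §3.1] -/
theorem integral_seriesSum_eq (ν : Measure ℕ) [IsProbabilityMeasure ν]
    (hν : ∀ n, ν (Set.Ici n) ≠ 0) {a : ℝ} {c : ℕ → ℝ} (hc : ∀ n, 0 ≤ c n) {f : ℝ → ℝ≥0}
    (hf : ∀ x, a ≤ x → HasSum (fun n => c n * (x - a) ^ n) (f x : ℝ))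
    (hi : Integrable (fun x : ℝ => x) π) (hX : ∀ᵐ y ∂π, y ∈ Set.Ici a) :
    ∫ p, seriesSum a c (debiasWeight ν) p.1 p.2 ∂(inputLaw ν π) = f (∫ y, y ∂π) := by
  rw [integral_eq_lintegral_of_nonneg_ae
      (seriesSum_ae_nonneg π ν hc (debiasWeight_nonneg ν) hX)
      (measurable_seriesSum_uncurry a c _).aestronglyMeasurable]
  have h := isFactoryOn_seriesAlgorithm ν hν hc hf π hi hX
  simp_rw [seriesAlgorithm_run] at h
  rw [h, ENNReal.coe_toReal]

end Series


/-! ## §3.2, `𝒳 = [a, b]`: Theorem 3.1 — the necessity of the polynomial lower bound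

Source, VERBATIM [JacobThiery2015, §3.2]: "The case of a bounded interval `𝒳 = [a,b]` is the most
related to the Bernoulli factory … Theorem 3.1 shows in fact that (eqconditionconstructibility)
`∃ ε > 0, ∃ n ∈ ℕ, ∀ x ∈ [a,b]  f(x) ≥ ε min((x−a)^n, (b−x)^n)` is a necessary and sufficient
condition for an `f`-factory to exist."  **"Theorem 3.1.** Let `𝒳 = [a,b]` be a real interval and
`f : 𝒳 → ℝ⁺` a continuous function that is not identically zero.  There exists an `f`-factory if
and only if condition (eqconditionconstructibility) holds.  *Proof.* The sufficiency is proved as a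
consequence of the results proved in [Keane1994].  The proof of the necessity requires different
arguments. … *Necessity.* For notational convenience, we present the proof in the case `𝒳 = [0,1]`.
… By Definition 2 for any `z ∈ [0,1]` and an i.i.d. sequence `(X_n)` of Bernoulli random variables
with mean `z ∈ [0,1]`, we have `f(z) = E(Σ_n Ψ_n(X_{1:n})) = Σ_n Σ_{x_{1:n} ∈ {0,1}ⁿ}
P(X_{1:n} = x_{1:n}) Ψ_n(x_{1:n})` … `P(X_{1:n} = x_{1:n}) = z^r (1−z)^{n−r}`, and the above double
sum can be written as `f(z) = Σ_{p,q} c_{p,q} z^p (1−z)^q` for some nonnegative coefficient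
`c_{p,q} ≥ 0`.  Condition (eqconditionconstructibility) follows. □"

Lean reading.  Only the NECESSITY half is typed (the sufficiency half rests on the Keane–O'Brien
construction of Bernoulli factories, which the tree does not have — TODO(general form)).  The
printed Bernoulli inputs are the two-point laws `twoPoint a b z = (1−z) δ_a + z δ_b ∈ ℳ₁([a,b])`
(mean `a + z(b−a)`); the printed `Ψ_n(x_{1:n})` (expected output given the first `n` inputs) is
`Algorithm.condOut ν n x = E_U[φ_τ 1_{τ ≤ n}](x)`; `pattern a b s` is the input word with letters
`a`/`b` selected by `s : Fin n → Bool`.  The displayed double sum is used through its two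
consequences that the printed "Condition follows" invokes: ONE word `x_{1:n}` with `Ψ_n(x_{1:n}) > 0`
exists as soon as `f ≢ 0` (`exists_condOut_pos`), and then for EVERY `z`,
`f(a + z(b−a)) ≥ P_z(X_{1:n} = x_{1:n}) Ψ_n(x_{1:n}) ≥ min(z, 1−z)ⁿ Ψ_n(x_{1:n})`
(`condOut_mul_le_lintegral_run`), which is (eqconditionconstructibility) with
`ε = Ψ_n(x_{1:n})/(b−a)ⁿ` (capped at `1`).  Continuity of `f` is not needed for this half and is not
assumed.
-/

section Interval

variable {ν : Measure S} [IsProbabilityMeasure ν] (A : Algorithm S)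

/-- The two-point ("Bernoulli") input law on `{a, b}` with `P{b} = z`: `(1 − z) δ_a + z δ_b`
(= `mixture δ_b (1−z) a`). [cite: JacobThiery2015, §3.2 (proof of Theorem 3.1: "an i.i.d. sequence
`(X_n)` of Bernoulli random variables with mean `z ∈ [0,1]`")] -/
def twoPoint (a b : ℝ) (z : Set.Icc (0 : ℝ) 1) : Measure ℝ :=
  mixture (Measure.dirac b) (1 - z) a

/-- `1 − z ∈ [0, 1]` for `z ∈ [0, 1]`. [cite: JacobThiery2015, §3.2 (proof of Theorem 3.1)] -/
theorem one_sub_mem_Icc (z : Set.Icc (0 : ℝ) 1) : (1 - (z : ℝ)) ∈ Icc (0 : ℝ) 1 :=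
  ⟨by linarith [z.2.2], by linarith [z.2.1]⟩

/-- The two-point law is a probability law. [cite: JacobThiery2015, §3.2 (proof of Theorem 3.1)] -/
instance isProbabilityMeasure_twoPoint (a b : ℝ) (z : Set.Icc (0 : ℝ) 1) :
    IsProbabilityMeasure (twoPoint a b z) :=
  isProbabilityMeasure_mixture _ (one_sub_mem_Icc z) _

/-- The two-point law has a first moment. [cite: JacobThiery2015, §3.2 (proof of Theorem 3.1)] -/
theorem integrable_twoPoint (a b : ℝ) (z : Set.Icc (0 : ℝ) 1) :
    Integrable (fun x : ℝ => x) (twoPoint a b z) :=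
  integrable_mixture (integrable_dirac (by simp)) _ _

/-- Its mean is `a + z(b − a)` ("Bernoulli random variables with mean `z`", rescaled from `[0,1]`
to `[a,b]`: "`g(x) = f(a(1−x) + bx)/γ`"). [cite: JacobThiery2015, §3.2 (proof of Theorem 3.1 and the
paragraph before Theorem 3.1)] -/
theorem integral_twoPoint (a b : ℝ) (z : Set.Icc (0 : ℝ) 1) :
    ∫ x, x ∂(twoPoint a b z) = a + z * (b - a) := by
  unfold twoPoint
  rw [integral_mixture (integrable_dirac (by simp)) (one_sub_mem_Icc z), integral_dirac]
  ring

/-- The two-point law is carried by `[a, b]` ("`∈ ℳ₁(𝒳)`", `𝒳 = [a,b]`).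
[cite: JacobThiery2015, §3.2 (Theorem 3.1: "`𝒳 = [a,b]`")] -/
theorem ae_mem_Icc_twoPoint {a b : ℝ} (hab : a ≤ b) (z : Set.Icc (0 : ℝ) 1) :
    ∀ᵐ x ∂(twoPoint a b z), x ∈ Set.Icc a b :=
  ae_mem_mixture (by rw [ae_dirac_eq]; simpa using hab) _ (Set.left_mem_Icc.mpr hab)

/-- The two-point law is carried by the two letters `{a, b}`.
[cite: JacobThiery2015, §3.2 (proof of Theorem 3.1: "`x_{1:n} ∈ {0,1}ⁿ`")] -/
theorem ae_eq_or_eq_twoPoint (a b : ℝ) (z : Set.Icc (0 : ℝ) 1) :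
    ∀ᵐ x ∂(twoPoint a b z), x = a ∨ x = b := by
  have h : ∀ᵐ x ∂(twoPoint a b z), x ∈ ({a, b} : Set ℝ) :=
    ae_mem_mixture (by rw [ae_dirac_eq]; simp) _ (by simp)
  filter_upwards [h] with x hx
  simpa using hx

/-- The letter `b` has mass at least `z`. [cite: JacobThiery2015, §3.2 (proof of Theorem 3.1:
"`P(X_{1:n} = x_{1:n}) = z^r (1−z)^{n−r}`")] -/
theorem ofReal_le_twoPoint_b (a b : ℝ) (z : Set.Icc (0 : ℝ) 1) :
    ENNReal.ofReal z ≤ twoPoint a b z {b} := by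
  simp only [twoPoint, mixture, Measure.coe_add, Measure.coe_smul, Pi.add_apply, Pi.smul_apply,
    smul_eq_mul, Measure.dirac_apply_of_mem (Set.mem_singleton b), mul_one, sub_sub_cancel]
  exact le_self_add

/-- The letter `a` has mass at least `1 − z`. [cite: JacobThiery2015, §3.2 (proof of Theorem 3.1:
"`P(X_{1:n} = x_{1:n}) = z^r (1−z)^{n−r}`")] -/
theorem ofReal_le_twoPoint_a (a b : ℝ) (z : Set.Icc (0 : ℝ) 1) :
    ENNReal.ofReal (1 - z) ≤ twoPoint a b z {a} := by
  simp only [twoPoint, mixture, Measure.coe_add, Measure.coe_smul, Pi.add_apply, Pi.smul_apply,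
    smul_eq_mul, Measure.dirac_apply_of_mem (Set.mem_singleton a), mul_one]
  exact le_add_self

/-- The input word with letters `a` (where `s i = false`) and `b` (where `s i = true`).
[cite: JacobThiery2015, §3.2 (proof of Theorem 3.1: "`x_{1:n} = (x_1, …, x_n) ∈ {0,1}ⁿ`")] -/
def pattern (a b : ℝ) {n : ℕ} (s : Fin n → Bool) : Fin n → ℝ := fun i => if s i then b else a

/-- Every letter of a pattern has mass at least `min(z, 1−z)` under the two-point law.
[cite: JacobThiery2015, §3.2 (proof of Theorem 3.1)] -/
theorem ofReal_min_le_twoPoint_pattern (a b : ℝ) (z : Set.Icc (0 : ℝ) 1) {n : ℕ}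
    (s : Fin n → Bool) (i : Fin n) :
    ENNReal.ofReal (min (z : ℝ) (1 - z)) ≤ twoPoint a b z {pattern a b s i} := by
  unfold pattern
  by_cases h : s i
  · simp only [h, if_true]
    exact (ENNReal.ofReal_le_ofReal (min_le_left _ _)).trans (ofReal_le_twoPoint_b a b z)
  · simp only [h]
    exact (ENNReal.ofReal_le_ofReal (min_le_right _ _)).trans (ofReal_le_twoPoint_a a b z)

/-- **`P_z(X_{1:n} = x_{1:n}) ≥ min(z, 1−z)ⁿ`** for every word `x_{1:n} ∈ {a,b}ⁿ` (the printed
`z^r(1−z)^{n−r}`, bounded below). [cite: JacobThiery2015, §3.2 (proof of Theorem 3.1: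
"`P(X_{1:n} = x_{1:n}) = z^r (1−z)^{n−r}`")] -/
theorem pow_le_pi_twoPoint_pattern (a b : ℝ) (z : Set.Icc (0 : ℝ) 1) {n : ℕ} (s : Fin n → Bool) :
    ENNReal.ofReal (min (z : ℝ) (1 - z)) ^ n ≤
      (Measure.pi fun _ : Fin n => twoPoint a b z) {pattern a b s} := by
  rw [← Set.univ_pi_singleton (pattern a b s), Measure.pi_pi]
  calc ENNReal.ofReal (min (z : ℝ) (1 - z)) ^ n
      = ∏ _i : Fin n, ENNReal.ofReal (min (z : ℝ) (1 - z)) := by simp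
    _ ≤ ∏ i : Fin n, twoPoint a b z {pattern a b s i} :=
        Finset.prod_le_prod' fun i _ => ofReal_min_le_twoPoint_pattern a b z s i

namespace Algorithm

/-- **`Ψ_n(x_{1:n})`**: the expected output (over the auxiliary randomness) given the first `n`
inputs, on the event that the algorithm has stopped by then — `E_U[φ_τ 1_{τ ≤ n}](x)`.
[cite: JacobThiery2015, §3.2 (proof of Theorem 3.1: "We define the expected output given `x_{1:n}`
by `Ψ_n(x_{1:n}) = E(1_{F_n(x_{1:n})} φ_n(U, x_1, …, x_n))`")] -/
def condOut (ν : Measure S) (n : ℕ) (x : Fin n → ℝ) : ℝ≥0∞ := ∫⁻ u, A.runByFin n (u, x) ∂ν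

/-- `Ψ_n` is measurable. [cite: JacobThiery2015, §3.2 (proof of Theorem 3.1)] -/
theorem measurable_condOut (ν : Measure S) [SFinite ν] (n : ℕ) : Measurable (A.condOut ν n) :=
  (A.measurable_runByFin n).lintegral_prod_left'

/-- `E_{U,X}[φ_τ 1_{τ ≤ n}] = E_X[Ψ_n(X_{1:n})]` (Tonelli). [cite: JacobThiery2015, §3.2 (proof of
Theorem 3.1: "`f(z) = E(Σ_n Ψ_n(X_{1:n}))`")] -/
theorem lintegral_runBy_eq_lintegral_condOut (ν : Measure S) [IsProbabilityMeasure ν]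
    (π : Measure ℝ) [IsProbabilityMeasure π] (n : ℕ) :
    ∫⁻ p, A.runBy n p ∂(inputLaw ν π) =
      ∫⁻ x, A.condOut ν n x ∂(Measure.pi fun _ : Fin n => π) := by
  rw [A.lintegral_runBy_eq ν π n,
    lintegral_prod_symm _ (A.measurable_runByFin n).aemeasurable]
  rfl

end Algorithm

/-- **The lower bound behind "Condition follows"**: for every word `x_{1:n} ∈ {a,b}ⁿ` and every
`z ∈ [0,1]`, `Ψ_n(x_{1:n}) · min(z,1−z)ⁿ ≤ Ψ_n(x_{1:n}) P_z(X_{1:n} = x_{1:n}) ≤ E_z[φ_τ 1_{τ≤n}] ≤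
E_z[𝒜(U,X)]` — the one term of the printed double sum `f(z) = Σ_n Σ_{x_{1:n}} P(X_{1:n} = x_{1:n})
Ψ_n(x_{1:n})` that is kept, non-negativity of the output doing the rest.
[cite: JacobThiery2015, §3.2 (proof of Theorem 3.1, the two displays for `f(z)`)] -/
theorem condOut_mul_le_lintegral_run (a b : ℝ) (z : Set.Icc (0 : ℝ) 1) {n : ℕ} (s : Fin n → Bool) :
    A.condOut ν n (pattern a b s) * ENNReal.ofReal (min (z : ℝ) (1 - z)) ^ n ≤
      ∫⁻ p, A.run p ∂(inputLaw ν (twoPoint a b z)) := by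
  set ρ : Measure (Fin n → ℝ) := Measure.pi fun _ : Fin n => twoPoint a b z with hρ
  calc A.condOut ν n (pattern a b s) * ENNReal.ofReal (min (z : ℝ) (1 - z)) ^ n
      ≤ A.condOut ν n (pattern a b s) * ρ {pattern a b s} := by
        gcongr
        exact pow_le_pi_twoPoint_pattern a b z s
    _ = ∫⁻ x in {pattern a b s}, A.condOut ν n x ∂ρ := (lintegral_singleton _ _).symm
    _ ≤ ∫⁻ x, A.condOut ν n x ∂ρ := setLIntegral_le_lintegral _ _
    _ = ∫⁻ p, A.runBy n p ∂(inputLaw ν (twoPoint a b z)) :=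
        (A.lintegral_runBy_eq_lintegral_condOut ν (twoPoint a b z) n).symm
    _ ≤ ∫⁻ p, A.run p ∂(inputLaw ν (twoPoint a b z)) := lintegral_mono fun p => A.runBy_le_run n p

/-- **Existence of a charged word**: if the expected output under SOME two-point input law is
positive and finite, then some `Ψ_n(x_{1:n})`, `x_{1:n} ∈ {a,b}ⁿ`, is positive ("for some
nonnegative coefficient `c_{p,q} ≥ 0`" — not all of them vanish when `f ≢ 0`).  Proof:
`E[𝒜] = sup_n E[φ_τ 1_{τ≤n}]` (eqlimit), and `E_z[φ_τ 1_{τ≤n}] = E_z[Ψ_n(X_{1:n})]` with `X_{1:n}`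
a.s. a word in `{a,b}ⁿ`. [cite: JacobThiery2015, §3.2 (proof of Theorem 3.1, last display)] -/
theorem exists_condOut_pos (a b : ℝ) (z : Set.Icc (0 : ℝ) 1)
    (hpos : 0 < ∫⁻ p, A.run p ∂(inputLaw ν (twoPoint a b z)))
    (hfin : ∫⁻ p, A.run p ∂(inputLaw ν (twoPoint a b z)) ≠ ⊤) :
    ∃ (n : ℕ) (s : Fin n → Bool), 0 < A.condOut ν n (pattern a b s) := by
  rw [← A.iSup_lintegral_runBy hfin, lt_iSup_iff] at hpos
  obtain ⟨n, hn⟩ := hpos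
  rw [A.lintegral_runBy_eq_lintegral_condOut ν (twoPoint a b z) n] at hn
  by_contra hneg
  simp only [not_exists, not_lt, nonpos_iff_eq_zero] at hneg
  -- a.s. every input word is a pattern, on which `Ψ_n` vanishes
  have hae : ∀ᵐ x ∂(Measure.pi fun _ : Fin n => twoPoint a b z), ∀ i, x i = a ∨ x i = b := by
    rw [ae_all_iff]
    intro i
    exact (Measure.tendsto_eval_ae_ae (μ := fun _ : Fin n => twoPoint a b z) (i := i)).eventually
      (ae_eq_or_eq_twoPoint a b z)
  have hzero : ∫⁻ x, A.condOut ν n x ∂(Measure.pi fun _ : Fin n => twoPoint a b z) = 0 := by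
    rw [← lintegral_zero]
    refine lintegral_congr_ae ?_
    filter_upwards [hae] with x hx
    have hx' : x = pattern a b (fun i => decide (x i = b)) := by
      funext i
      by_cases hb : x i = b
      · simp [pattern, hb]
      · have ha : x i = a := (hx i).resolve_right hb
        rw [show pattern a b (fun i => decide (x i = b)) i = a by simp [pattern, hb]]
        exact ha
    rw [hx']
    exact hneg n _
  exact (lt_irrefl _) (hzero ▸ hn)

variable {A} in
/-- **THEOREM 3.1 (Jacob–Thiery), necessity**: "Let `𝒳 = [a,b]` be a real interval and
`f : 𝒳 → ℝ⁺` … not identically zero.  There exists an `f`-factory [only if]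
`∃ ε > 0, ∃ n ∈ ℕ, ∀ x ∈ [a,b], f(x) ≥ ε min((x−a)ⁿ, (b−x)ⁿ)`."  (The printed theorem is an
"if and only if" for continuous `f`; the converse — sufficiency, via Keane–O'Brien Bernoulli
factories — is not formalised; continuity is not used for this half.)
[cite: JacobThiery2015, §3.2 Theorem 3.1 (necessity) and condition (eqconditionconstructibility)] -/
theorem JacobThiery2015_thm_3_1_necessity {a b : ℝ} (hab : a < b) {f : ℝ → ℝ≥0}
    (hA : IsFactoryOn A ν (Set.Icc a b) f) (hf : ∃ x ∈ Set.Icc a b, f x ≠ 0) :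
    ∃ ε : ℝ, 0 < ε ∧ ∃ n : ℕ, ∀ x ∈ Set.Icc a b,
      ε * min ((x - a) ^ n) ((b - x) ^ n) ≤ (f x : ℝ) := by
  have hba : 0 < b - a := sub_pos.mpr hab
  -- the factory identity on the two-point laws: `E_z[𝒜] = f(a + z(b−a))`
  have hE : ∀ z : Set.Icc (0 : ℝ) 1,
      ∫⁻ p, A.run p ∂(inputLaw ν (twoPoint a b z)) = f (a + z * (b - a)) := by
    intro z
    rw [hA (twoPoint a b z) (integrable_twoPoint a b z) (ae_mem_Icc_twoPoint hab.le z),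
      integral_twoPoint]
  -- the coordinate of a point of `[a,b]` in `[0,1]`
  have hcoord : ∀ x ∈ Set.Icc a b, (x - a) / (b - a) ∈ Set.Icc (0 : ℝ) 1 := fun x hx =>
    ⟨div_nonneg (by linarith [hx.1]) hba.le, (div_le_one hba).mpr (by linarith [hx.2])⟩
  have hback : ∀ x : ℝ, a + (x - a) / (b - a) * (b - a) = x := fun x => by
    field_simp; ring
  -- Step 1: a charged word, from the point where `f ≠ 0`
  obtain ⟨x₀, hx₀, hfx₀⟩ := hf
  set z₀ : Set.Icc (0 : ℝ) 1 := ⟨(x₀ - a) / (b - a), hcoord x₀ hx₀⟩ with hz₀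
  have hE₀ : ∫⁻ p, A.run p ∂(inputLaw ν (twoPoint a b z₀)) = f x₀ := by
    rw [hE z₀]
    simp only [hz₀, hback]
  obtain ⟨n, s, hΨ⟩ := exists_condOut_pos A a b z₀
    (by rw [hE₀]; exact_mod_cast pos_iff_ne_zero.mpr hfx₀) (by rw [hE₀]; exact ENNReal.coe_ne_top)
  -- Step 2: the constant `ε = min(Ψ, 1)/(b−a)ⁿ`
  set c : ℝ≥0∞ := min (A.condOut ν n (pattern a b s)) 1 with hc
  have hc_top : c ≠ ⊤ := ne_top_of_le_ne_top ENNReal.one_ne_top (min_le_right _ _)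
  have hc_pos : 0 < c := lt_min hΨ zero_lt_one
  have hcR : 0 < c.toReal := ENNReal.toReal_pos hc_pos.ne' hc_top
  refine ⟨c.toReal / (b - a) ^ n, div_pos hcR (pow_pos hba n), n, fun x hx => ?_⟩
  -- Step 3: the lower bound at `x`, through `z = (x−a)/(b−a)`
  set z : Set.Icc (0 : ℝ) 1 := ⟨(x - a) / (b - a), hcoord x hx⟩ with hz
  have hmin0 : 0 ≤ min (z : ℝ) (1 - z) := le_min z.2.1 (by linarith [z.2.2])
  have key : c * ENNReal.ofReal (min (z : ℝ) (1 - z)) ^ n ≤ (f x : ℝ≥0∞) := by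
    have h1 := condOut_mul_le_lintegral_run (ν := ν) A a b z s
    rw [hE z] at h1
    simp only [hz, hback] at h1
    calc c * ENNReal.ofReal (min (z : ℝ) (1 - z)) ^ n
        ≤ A.condOut ν n (pattern a b s) * ENNReal.ofReal (min (z : ℝ) (1 - z)) ^ n := by
          gcongr
          exact min_le_left _ _
      _ ≤ (f x : ℝ≥0∞) := h1
  -- back to real numbers
  have key' : c.toReal * (min (z : ℝ) (1 - z)) ^ n ≤ (f x : ℝ) := by
    have h2 := ENNReal.toReal_mono ENNReal.coe_ne_top key
    rw [ENNReal.toReal_mul, ENNReal.toReal_pow, ENNReal.toReal_ofReal hmin0] at h2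
    simpa using h2
  -- `min(z, 1−z)ⁿ (b−a)ⁿ = min((x−a)ⁿ, (b−x)ⁿ)`
  have hz1 : (z : ℝ) = (x - a) / (b - a) := rfl
  have hz2 : 1 - (z : ℝ) = (b - x) / (b - a) := by rw [hz1]; field_simp; ring
  have hminpow : min ((x - a) ^ n) ((b - x) ^ n) = (min (z : ℝ) (1 - z)) ^ n * (b - a) ^ n := by
    rw [← mul_pow, min_mul_of_nonneg _ _ hba.le, hz1, hz2, div_mul_cancel₀ _ hba.ne',
      div_mul_cancel₀ _ hba.ne']
    rcases le_total (x - a) (b - x) with h | h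
    · rw [min_eq_left h, min_eq_left (pow_le_pow_left₀ (by linarith [hx.1]) h n)]
    · rw [min_eq_right h, min_eq_right (pow_le_pow_left₀ (by linarith [hx.2]) h n)]
  rw [hminpow]
  calc c.toReal / (b - a) ^ n * ((min (z : ℝ) (1 - z)) ^ n * (b - a) ^ n)
      = c.toReal * (min (z : ℝ) (1 - z)) ^ n := by
        field_simp
    _ ≤ (f x : ℝ) := key'

variable {A} in
/-- Corollary: an `f`-factory on `[a, b]` with `f ≢ 0` has `f > 0` on the open interval `(a, b)`
(the bound `ε min((x−a)ⁿ, (b−x)ⁿ)` is positive there). [cite: JacobThiery2015, §3.2 Theorem 3.1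
(necessity)] -/
theorem IsFactoryOn.pos_of_mem_Ioo {a b : ℝ} (hab : a < b) {f : ℝ → ℝ≥0}
    (hA : IsFactoryOn A ν (Set.Icc a b) f) (hf : ∃ x ∈ Set.Icc a b, f x ≠ 0) :
    ∀ x ∈ Set.Ioo a b, 0 < f x := by
  obtain ⟨ε, hε, n, h⟩ := JacobThiery2015_thm_3_1_necessity hab hA hf
  intro x hx
  have h1 := h x (Set.Ioo_subset_Icc_self hx)
  have h2 : 0 < ε * min ((x - a) ^ n) ((b - x) ^ n) :=
    mul_pos hε (lt_min (pow_pos (sub_pos.mpr hx.1) n) (pow_pos (sub_pos.mpr hx.2) n))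
  exact_mod_cast h2.trans_le h1

variable {A} in
/-- Corollary (contrapositive): a function on `[a,b]` that vanishes somewhere in the OPEN interval
but not everywhere on `[a,b]` has no factory on `[a,b]` — e.g. no sign-less unbiased estimator of
`|m₁ − θ|`, `(m₁ − θ)²` or `max(m₁ − θ, 0)` for an interior `θ`. [cite: JacobThiery2015, §3.2
Theorem 3.1 (necessity)] -/
theorem not_isFactoryOn_of_zero_mem_Ioo {a b : ℝ} (hab : a < b) {f : ℝ → ℝ≥0} {θ : ℝ}
    (hθ : θ ∈ Set.Ioo a b) (hfθ : f θ = 0) (hf : ∃ x ∈ Set.Icc a b, f x ≠ 0) :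
    ¬ IsFactoryOn A ν (Set.Icc a b) f := fun hA =>
  (hfθ ▸ (hA.pos_of_mem_Ioo hab hf θ hθ)).false

end Interval

end NonnegativeUnbiased

end Literature.Probability.Moments

end
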